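import Literature.MathematicalPhysics.QuantumFieldTheory.Balaban1983to89.B5
import Literature.MathematicalPhysics.QuantumFieldTheory.Balaban1983to89.B5Prop11Leaves
import Literature.MathematicalPhysics.QuantumFieldTheory.Balaban1983to89.B5Strip145

/-!
# Beta/SymbolExpansion — the k-UNIFORM second-order expansion at p′ = 0 of Bałaban's symbols
# `a_μ = Δ₀φ_μ` (1.62) and `σ_k` (1.66) of [Balaban1984PropagatorsI] §1 at U = 1
# (β sub-cell row an1, step (L1) of BETA-SPEC §8.6; GAPS C-sb12-8 / C-an1-8)

HONEST FRAMING (cell `pub-balaban`, BETA-SPEC): discharging the flow-side hypothesis `BetaPertH` of Bałaban's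
[Balaban1987RG1] Theorem 2 would make the ultraviolet STABILITY of four-dimensional pure Yang–Mills lattice gauge
theory UNCONDITIONAL (in the interval-hypothesis sense of [Balaban1989LargeFieldII] p. 355) — a real constructive-QFT
result; it is NOT the continuum limit and NOT the Clay problem.  This module asserts NOTHING about Bałaban's
β-functions and introduces no `def … : Prop` hypothesis shape (D-0026): it transcribes two printed DEFINITIONS of
[Balaban1984PropagatorsI] (T. Bałaban, Propagators and renormalization transformations for lattice gauge theories I,
Commun. Math. Phys. 95 (1984) 17–40; INDEX B5) in the momentum vocabulary ALREADY vendored by `B4Strip` (b04-g2) and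
`B5Prop11Leaves` (b05-g2), and proves elementary real-analysis facts about them.  Every proved statement is
[folklore]-tagged mathematics about those definitions; no statement of the papers under audit is used.

## Printed inputs (verbatim, with page; PDF page = printed page − 16)

* (1.31) p. 23: `Δ(p) = Σ_μ |∂_μ(p)|²`, `∂_μ(p) = (e^{iηp_μ} − 1)/η`, `u_k(p) = Π_μ ∂¹_μ(p′)/∂_μ(p)` with
  `∂¹_μ(p′) = e^{ip′_μ} − 1`, momenta `p = p′ + l`, `p′_μ ∈ [−π, π)`, `l_μ = 2πm_μ` over a complete residue system
  mod `L^k`, `η = L^{−k}`; p. 24: `Δ₀(p′) = Σ_μ |e^{ip′_μ} − 1|²`.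
* (1.61)–(1.62) p. 28: `v_μ(p) = ∂¹_μ(p′)/∂_μ(p)`; `φ_μ(p′) = Σ_l |u(p′+l)|² |v_μ(p′+l)|² / Δ(p′+l)`; «Multiplying
  φ_μ(p′) by Δ₀(p′), we get a well-defined positive function for all p′ ∈ T̃₁^{(k)}, 0 < γ₀ ≤ Δ₀(p′)φ_μ(p′) ≤ γ₁».
* (1.66)–(1.67) p. 29: `⟨B, Δ_k B⟩ = ⟨∂₁B, σ_k ∂₁B⟩ = ½ Σ_{μν} (2π)^{−d} ∫dp′ [(Σ_λ |∂¹_λ(p′)|²/(Δ₀²(p′)φ_λ(p′)))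
  · Δ₀(p′)φ_μ(p′) Δ₀(p′)φ_ν(p′)]⁻¹ |(∂₁B)~_{μν}(p′)|²`; «The function under the integral is bounded from below and
  above by positive constants γ₀, γ₁ dependent on d only»; (1.67) `γ₀⟨∂₁B,∂₁B⟩ ≤ ⟨B,Δ_kB⟩ ≤ γ₁⟨∂₁B,∂₁B⟩`.
* (1.84)–(1.85) p. 31–32 (through `B5Prop11Leaves.phiMu`): `φ_μ^{(1.84)} = 1 + a·Σ_l |u|²|v_μ|²/Δ(p′+l)`, so that
  `Δ₀φ_μ^{(1.84)} = Δ₀ + a·a_μ` with `a_μ` the (1.62) object (`delta1r_mul_phiMu` below).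
* (1.45) p. 26 (for §5 only): the scalar function `Y/(aX + Δ₀)²` of tree `B5.bound145_scalar` (GAPS G-B5-13).

## Dictionary (= the `B5Prop11Leaves` dictionary; `n = L^k = η⁻¹ ≥ 1`, `l = 2πk`, `k : Fin d → Fin n`)

`|∂¹_μ(p′)|² = S1r (p′_μ)`, `Δ₀(p′) = Delta1r 0 p′`, `|∂_μ(p′+l)|² = Sxir n (p′_μ + 2πk_μ)`,
`Δ(p′+l) = DeltaXir n 0 (shiftr n k p′)`, `|v_μ(p′+l)|² = uFactorr n k_μ p′_μ` (removable point filled by `1`),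
`|u(p′+l)|² = Ur n k p′`.  NEW here: `aSym n μ p′ := a_μ(p′) := Δ₀(p′)φ_μ(p′)` of (1.62) (the l-sum written with
`Δ₀|u|²|v_μ|²/Δ(p′+l)` inside) and `sigmaSym n μ ν p′ := σ_{k,μν}(p′)` := the bracket `[…]⁻¹` of (1.66) rewritten
with `a = Δ₀φ`: `[(Σ_λ |∂¹_λ|²/(Δ₀ a_λ)) a_μ a_ν]⁻¹`; `|p′|² := Σ_ν p′_ν²`.  Statements carry `p′ ≠ 0` in the form
`(ν₀) (hν₀ : p′ ν₀ ≠ 0)` where print does, and `|p′_ν| ≤ π`.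

## Reused, NOT re-proved (tree `B4Strip`, `B5Prop11Leaves`, `B5Strip145`, `B5`)

`S1r_eq/nonneg/ge` (Jordan), `Sxir_le`, `Sxir_pos`, `uFactorr_nonneg/le_one/zero_ge`, `Ur_nonneg/le_one/zero_ge`,
`Delta1r_le_DeltaXir_shift` (`Δ₀(p′) ≤ Δ(p′+l)` for every l, from the aliasing inequality `S1r_le_Sxir_shift`),
`DeltaXir_le_Delta1r`, `Delta1r_le`, `Delta1r_pos`, `DeltaXir_pos`, `shiftr_zero`, the sum rule `sum_Ur_eq_one`
(`Σ_l |u(p′+l)|² = 1`, E4), `phiMu` / `ineq185_lower` ((1.84)–(1.85)), the real/complex dictionary `ofRealVec`,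
`U_ofReal`, `Delta1_ofReal`, `DeltaXi_ofReal`, `shift_ofReal`, the literal transcription `B5Strip145.m145` of (1.45),
and the scalar lemma `B5.bound145_scalar`.

## What is proved here (all k-uniform: for every `n ≥ 1`; constants explicit)

* §1 two one-variable leaves absent upstream: `S1r_le_sq` (`|e^{ix}−1|² ≤ x²`), the cubic bound `sq_mul_le_S1r`
  (`x²(1 − x²/12) ≤ |e^{ix}−1|²`, i.e. `sin²y ≥ y² − y⁴/3` — the inequality [King1986] (4.10) p. 671 uses), and the
  second-order lower bound of the `l = 0` weight `one_sub_sq_le_uFactorr_zero` (`1 − x²/12 ≤ |v(p′)|²`).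
* §2 THEOREM A for `a_μ` of (1.62): `aSym_le_one : a_μ(p′) ≤ 1` (so the printed γ₁ of (1.62) may be taken EQUAL TO 1,
  all d); `one_sub_sq_le_aSym : 1 − |p′|²/4 ≤ a_μ(p′)` (constant 1/4 independent of d, and sharp: for p′ ∥ e_μ,
  `1 − a_μ = (1 − η²)p′²/4 + O(p′⁴)`); `jordan_le_aSym : (4/π²)^(d+2) ≤ a_μ(p′)` (explicit γ₀(d));
  `abs_aSym_sub_one_le : |a_μ(p′) − 1| ≤ |p′|²/4`.  Consequence for (1.85): `delta1r_mul_phiMu`,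
  `ineq185_upper_sharp : Δ₀φ_μ^{(1.84)} ≤ Δ₀ + a ≤ 4d + a` (sharpening `B5Prop11Leaves.ineq185_upper'`'s `4d + a + ad`)
  and `abs_delta1r_mul_phiMu_sub_le : |Δ₀φ_μ^{(1.84)} − (Δ₀ + a)| ≤ a|p′|²/4`.
* §3 THEOREM B for `σ_{k,μν}` of (1.66) (abstract envelope lemma `inv_weighted_bounds` + Theorem A):
  `sigmaSym_second_order : 1 − |p′|²/4 ≤ σ ≤ (1 − |p′|²/4)⁻²`, `|σ − 1| ≤ (|p′|²/2)/(1 − |p′|²/4)²` for `|p′|² < 4`;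
  `abs_sigmaSym_sub_one_le : |σ − 1| ≤ (8/9)|p′|²` on `|p′|² ≤ 1`; `sigmaSym_global : (4/π²)^(d+2) ≤ σ ≤ (π²/4)^(2d+4)`
  — explicit γ₀(d), γ₁(d) for (1.67).
* §4 non-vacuity of the hypotheses; the `k = 0` normalisation `|v(p′)|² = 1`.
* §5 the two abstract hypotheses `hYX : Y ≤ X`, `hcX : (2/π)^{2d+2} ≤ X` of tree `B5.bound145_scalar` DISCHARGED over the
  symbols (`Y145_le_X145`, `jordan_le_X145`; also `X145_le_one`, `jordan_le_Y145`), giving `bound145_symbol :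
  Y/(aX + Δ₀)² ≤ ((4/π²)^(d+1)a²)⁻¹` for all a > 0, p′ ≠ 0, k, and — through the `B4Strip` real/complex dictionary —
  `m145_ofRealVec` / `m145_real_bounds : (4/π²)^(d+2)/(a+4d)² ≤ ‖B5Strip145.m145 n a p′‖ ≤ (π/2)^{2d+2}a⁻²` on the
  punctured real zone: the p. 26 sentence «γ₀ ≦ Q′_kG′_k²Q′_k* ≦ γ₁» for the LITERAL tree transcription of (1.45) with
  the provable constants (G-B5-13 replacement bound, kernel-checked from the printed definitions end to end).
* §6 (v2.1) `l = 0` DOMINANCE AT FOURTH ORDER: `aSymZero` (`T₀ := Δ₀|u(p′)|²|v_μ(p′)|²/Δ^η(p′)`, the l = 0 term),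
  `aSym_sub_aSymZero_le : a_μ − T₀ ≤ Δ₀(p′)(1 − |u(p′)|²)/4`, `aSym_sub_aSymZero_le_pow_four : 0 ≤ a_μ − T₀ ≤ |p′|⁴/48`
  (every l ≠ 0 term carries `Δ₀(p′) = O(|p′|²)` and `|u(p′+l)|² = O(|p′|²)` against `Δ(p′+l) ≥ 4`), the closed form
  `aSymZero_eq_prod`, its envelope `aSymZero_envelope`, and the Laplacian ratio `Δ₀(p′)/Δ^η(p′)` (the one ingredient of
  `T₀` not smooth at p′ = 0): `DeltaXir_sub_Delta1r_le : 0 ≤ Δ^η − Δ₀ ≤ Σ_ν p′_ν⁴/12`, `one_sub_lapRatio_bounds :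
  0 ≤ 1 − Δ₀/Δ^η ≤ Σ_ν p′_ν⁴/(12Δ^η) ≤ (π²/48)|p′|²`, `DeltaXir_one_eq_Delta1r` (ratio `= 1` at k = 0).  So ALL of the
  second-order structure of `a_μ − 1` sits in the explicit `T₀`.  Recorded on paper + numerics only (HOME/BETA/AN1.md §13,
  limits, NOT kernel statements): `a_μ = 1 − [(1−η²)/12](|p′|² + p′_μ² + Σ_ν p′_ν⁴/|p′|²) + O(|p′|⁴)` (so `a_μ` is C¹, not
  C², at 0), while `σ_{k,μν} = 1 + [(1−η²)/12](|p′|² + p′_μ² + p′_ν²) + O(|p′|⁴)` — the conormal terms cancel in (1.66).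
* §7 (v2.2) EXACT FACTORISATION of `σ_{k,μν}`: with `F_k := 1/(|u(p′)|²|v_μ(p′)|²|v_ν(p′)|²)` (`Fk`, explicit — a
  product of the printed one-variable function `1/|v(s)|² = L^{2k}sin²(s/2L^k)/sin²(s/2)`), the partition weights
  `ω_λ := Δ^η_λ/Δ^η` (`omegaW`, `Σ_λ ω_λ = 1`) and the alias ratios `t_λ := a_λ/T₀,λ ∈ [1, 1 + |p′|⁴/(48(4/π²)^(d+1))]`
  (`tRatio`, `one_le_tRatio`, `tRatio_sub_one_le'`): `sigmaSym_factorisation : σ_{k,μν} = F_k·[t_μ t_ν Σ_λ ω_λ/t_λ]⁻¹`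
  IDENTICALLY on the punctured zone (the Laplacian ratio `Δ₀/Δ^η` of `T₀` CANCELS against the transverse weights, since
  `|∂¹_λ|² = Δ^η_λ|v_λ|²`, `S1r_eq_Sxir_mul_uFactorr_zero`); hence `sigmaSym_Fk_bounds : F_k/(1+e)² ≤ σ_{k,μν} ≤ F_k(1+e)`,
  `e = |p′|⁴/(48(4/π²)^(d+1))` — i.e. `σ_k = F_k·(1 + O(|p′|⁴))` two-sided and UNIFORM IN k, with `one_le_Fk`,
  `Fk_le_local : F_k ≤ [(1−|p′|²/12)(1−p′_μ²/12)(1−p′_ν²/12)]⁻¹` (`|p′|² < 12`), `Fk_le_global : F_k ≤ (π²/4)^(d+2)`.  So the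
  second-order germ of `σ_k` is that of the explicit analytic `F_k` (on paper: `1 + [(1−η²)/12](|p′|² + p′_μ² + p′_ν²)`,
  one-variable Taylor), and ALL non-analytic content of `σ_k` sits in `Σ_λ ω_λ/t_λ` at relative order `|p′|⁴`.

## What this is for, and what it is NOT

BETA-SPEC §8.6 (L1) asks, at U = 1 and uniformly in k, that Bałaban's covariance symbols be the continuum ones plus
O(|p′|²)-relative corrections with k-independent constants (an input of the large-L window decomposition).  Theorems A/B
are the p′ → 0 half of that statement for the two scalar symbols print names, with the sharp constant; they AGREE with and
SHARPEN the cell's paper derivation GAPS C-sb12-8 (BETA-SPEC §8.6(h): C(d), C′(d) unspecified there).  NOT covered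
here (row file HOME/BETA/AN1.md §11.6/§13/§14): the germ LIMIT statements of §6's docstring (the exact Taylor coefficient of `F_k`),
the derivative / conormal / strip-analyticity (|Im p′| < δ) versions (by §7 these concern the alias ratios `t_λ` only), the Woodbury block
correction (1.70)–(1.83) of the full propagator, anything at U ≠ 1, and — of course — any statement about β.  Cell rule
honoured: no internally-minted statement enters as a cited fact; the only [cite:] tags sit on transcribed definitions.
-/

namespace Literature.MathematicalPhysics.QuantumFieldTheory.Balaban1983to89.Beta.SymbolExpansion

open Finset Real
open Literature.MathematicalPhysics.QuantumFieldTheory.Balaban1983to89.B4Strip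
open Literature.MathematicalPhysics.QuantumFieldTheory.Balaban1983to89.B5Prop11Leaves
open Literature.MathematicalPhysics.QuantumFieldTheory.Balaban1983to89.B5Strip145 (m145)

noncomputable section

/-! ## §1. One-variable leaves not present upstream -/

/-- `|e^{ix} − 1|² = S1r x ≤ x²` (from `1 − x²/2 ≤ cos x`). [folklore] -/
theorem S1r_le_sq (x : ℝ) : S1r x ≤ x ^ 2 := by
  unfold S1r; linarith [Real.one_sub_sq_div_two_le_cos (x := x)]

/-- `0 < S1r x` for `0 < |x| ≤ π`. [folklore] -/
theorem S1r_pos {x : ℝ} (hx : |x| ≤ π) (hx0 : x ≠ 0) : 0 < S1r x := by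
  have h1 := S1r_ge x hx
  have h2 : 0 < 4 * x ^ 2 / π ^ 2 := by positivity
  linarith

/-- cubic Taylor bound `x²(1 − x²/12) ≤ |e^{ix} − 1|² = 4 sin²(x/2)` for `|x| ≤ π`, i.e. `sin² y ≥ y² − y⁴/3`
(`y = x/2`) — the inequality [King1986] uses at (4.10) p. 671. [folklore] -/
theorem sq_mul_le_S1r {x : ℝ} (hx : |x| ≤ π) : x ^ 2 * (1 - x ^ 2 / 12) ≤ S1r x := by
  rw [S1r_eq]
  wlog h0 : 0 ≤ x generalizing x
  · have := this (x := -x) (by simpa using hx) (by linarith)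
    simpa [neg_div, Real.sin_neg] using this
  set y := x / 2 with hy
  have hy0 : 0 ≤ y := by positivity
  have h1 : y - y ^ 3 / 6 ≤ Real.sin y := Real.sin_ge_sub_cube hy0
  have hy2 : y ^ 2 ≤ 6 := by
    have : y ≤ 2 := by rw [hy]; linarith [Real.pi_lt_four, (abs_le.mp hx).2]
    nlinarith
  have h2 : 0 ≤ y - y ^ 3 / 6 := by nlinarith
  have h3 : (y - y ^ 3 / 6) ^ 2 ≤ Real.sin y ^ 2 := pow_le_pow_left₀ h2 h1 2
  have hx2 : x = 2 * y := by rw [hy]; ring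
  rw [hx2]
  nlinarith [h3, sq_nonneg y, mul_nonneg (mul_nonneg (sq_nonneg y) (sq_nonneg y)) (sq_nonneg y)]

/-- the `l = 0` weight to second order: `1 − x²/12 ≤ |v(p′)|² = uFactorr n 0 x` uniformly in `η = 1/n ∈ (0, 1]`,
`|x| ≤ π` (sharp: `|v(p′)|² = 1 − (1 − η²)x²/12 + O(x⁴)`). [folklore] -/
theorem one_sub_sq_le_uFactorr_zero (n : ℕ) (hn : 1 ≤ n) {x : ℝ} (hx : |x| ≤ π) :
    1 - x ^ 2 / 12 ≤ uFactorr n 0 x := by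
  rw [uFactorr, if_pos rfl]
  split_ifs with h0
  · rw [h0]; norm_num
  · have hDpos : 0 < Sxir n x := Sxir_pos n hn x h0 hx
    have hDle : Sxir n x ≤ x ^ 2 := Sxir_le n x
    have hnum := sq_mul_le_S1r hx
    by_cases hsign : 0 ≤ 1 - x ^ 2 / 12
    · have hx2 : 0 < x ^ 2 := by positivity
      calc 1 - x ^ 2 / 12 = x ^ 2 * (1 - x ^ 2 / 12) / x ^ 2 := by field_simp
        _ ≤ x ^ 2 * (1 - x ^ 2 / 12) / Sxir n x :=
            div_le_div_of_nonneg_left (mul_nonneg hx2.le hsign) hDpos hDle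
        _ ≤ S1r x / Sxir n x := div_le_div_of_nonneg_right hnum hDpos.le
    · have : 0 ≤ S1r x / Sxir n x := div_nonneg (S1r_nonneg _) hDpos.le
      linarith [not_le.mp hsign]

/-- at `k = 0` (`n = 1`, `η = 1`) the `l = 0` weight is `1`: `|v(p′)|² = 1` on `[−π,π]`. [folklore] -/
theorem uFactorr_one_zero {x : ℝ} (hx : |x| ≤ π) : uFactorr 1 0 x = 1 := by
  rw [uFactorr, if_pos rfl]
  split_ifs with h0
  · rfl
  · have h : Sxir 1 x = S1r x := by simp [Sxir, S1r]
    rw [h]; exact div_self (ne_of_gt (S1r_pos hx h0))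

/-- Weierstrass' product inequality `1 − Σ εⱼ ≤ Π (1 − εⱼ)` for `εⱼ ∈ [0, 1]`.  (The same statement is tree
`Literature.Computability.Complexity.ProductWeights.one_sub_sum_le_prod_one_sub`; kept `private` here to avoid a
cross-topic import.) [folklore] -/
private theorem one_sub_sum_le_prod_one_sub' {ι : Type*} (s : Finset ι) (ε : ι → ℝ)
    (h0 : ∀ j ∈ s, 0 ≤ ε j) (h1 : ∀ j ∈ s, ε j ≤ 1) : 1 - ∑ j ∈ s, ε j ≤ ∏ j ∈ s, (1 - ε j) := by
  classical
  induction s using Finset.induction_on with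
  | empty => simp
  | insert i s hi ih =>
    rw [Finset.sum_insert hi, Finset.prod_insert hi]
    have ih' := ih (fun j hj => h0 j (Finset.mem_insert_of_mem hj)) (fun j hj => h1 j (Finset.mem_insert_of_mem hj))
    have hS : 0 ≤ ∑ j ∈ s, ε j := Finset.sum_nonneg fun j hj => h0 j (Finset.mem_insert_of_mem hj)
    have hi0 := h0 i (Finset.mem_insert_self i s)
    have hi1 : 0 ≤ 1 - ε i := by linarith [h1 i (Finset.mem_insert_self i s)]
    calc 1 - (ε i + ∑ j ∈ s, ε j) ≤ (1 - ε i) * (1 - ∑ j ∈ s, ε j) := by nlinarith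
      _ ≤ (1 - ε i) * ∏ j ∈ s, (1 - ε j) := mul_le_mul_of_nonneg_left ih' hi1

/-! ## §2. `a_μ(p′) = Δ₀(p′)φ_μ(p′)` of (1.62) — Theorem A -/

variable {d : ℕ}

/-- `a_μ(p′) := Δ₀(p′)φ_μ(p′) = Σ_l Δ₀(p′)|u(p′+l)|²|v_μ(p′+l)|²/Δ(p′+l)` — the «well-defined positive function»
of [Balaban1984PropagatorsI] p. 28, (1.62) `G(k)(p′) = [Σ_μ |∂¹_μ(p′)|²/φ_μ(p′)]⁻¹`,
`φ_μ(p′) = Σ_l |u(p′+l)|²|v_μ(p′+l)|²/Δ(p′+l)`, with the printed claim `0 < γ₀ ≤ Δ₀(p′)φ_μ(p′) ≤ γ₁`.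
Here `l = 2πk`, `k : Fin d → Fin n`, `n = L^k`. [cite: Balaban1984PropagatorsI, (1.61)–(1.62) p.28] -/
def aSym (n : ℕ) [NeZero n] (μ : Fin d) (s : Fin d → ℝ) : ℝ :=
  ∑ k : Fin d → Fin n, Delta1r 0 s * Ur n k s * uFactorr n (k μ : ℕ) (s μ) / DeltaXir n 0 (shiftr n k s)

/-- each summand of `a_μ` is `≥ 0`. [folklore] -/
theorem aSym_summand_nonneg (n : ℕ) [NeZero n] (μ : Fin d) (s : Fin d → ℝ) (k : Fin d → Fin n) :
    0 ≤ Delta1r 0 s * Ur n k s * uFactorr n (k μ : ℕ) (s μ) / DeltaXir n 0 (shiftr n k s) :=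
  div_nonneg (mul_nonneg (mul_nonneg (Delta1r_nonneg 0 le_rfl s) (Ur_nonneg _ _ _)) (uFactorr_nonneg _ _ _))
    (DeltaXir_nonneg n 0 le_rfl _)

/-- `0 ≤ a_μ(p′)`. [folklore] -/
theorem aSym_nonneg (n : ℕ) [NeZero n] (μ : Fin d) (s : Fin d → ℝ) : 0 ≤ aSym n μ s :=
  Finset.sum_nonneg fun k _ => aSym_summand_nonneg n μ s k

/-- link with (1.84)–(1.85) as typed in `B5Prop11Leaves`: `Δ₀(p′)·φ_μ^{(1.84)}(p′) = Δ₀(p′) + a·a_μ(p′)`. [folklore] -/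
theorem delta1r_mul_phiMu (n : ℕ) [NeZero n] (a : ℝ) (μ : Fin d) (s : Fin d → ℝ) :
    Delta1r 0 s * phiMu n a μ s = Delta1r 0 s + a * aSym n μ s := by
  unfold phiMu aSym
  rw [mul_add, mul_one, Finset.mul_sum, Finset.mul_sum, Finset.mul_sum]
  congr 1
  refine Finset.sum_congr rfl fun k _ => ?_
  ring

/-- **Theorem A, upper half**: `a_μ(p′) ≤ 1` for every `p′ ∈ [−π,π]^d`, every `μ`, `d` and every `n = L^k ≥ 1` — so in
«`0 < γ₀ ≤ Δ₀(p′)φ_μ(p′) ≤ γ₁`» (p. 28) one may take `γ₁ = 1`.  Proof: termwise `Δ₀(p′) ≤ Δ(p′+l)` and `|v_μ|² ≤ 1`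
(`B5Prop11Leaves`), then the sum rule `Σ_l |u(p′+l)|² = 1` (E4). [folklore] -/
theorem aSym_le_one (n : ℕ) [NeZero n] (hn : 1 ≤ n) (s : Fin d → ℝ) (hs : ∀ ν, |s ν| ≤ π) (μ : Fin d) :
    aSym n μ s ≤ 1 := by
  unfold aSym
  rw [← sum_Ur_eq_one n hn s hs]
  refine Finset.sum_le_sum fun k _ => ?_
  have hu := Ur_nonneg n k s
  have hv0 := uFactorr_nonneg n (k μ : ℕ) (s μ)
  have hv1 := uFactorr_le_one n hn (k μ : ℕ) (s μ)
  have hr : Delta1r 0 s / DeltaXir n 0 (shiftr n k s) ≤ 1 :=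
    div_le_one_of_le₀ (Delta1r_le_DeltaXir_shift n hn k s) (DeltaXir_nonneg n 0 le_rfl _)
  have hr0 : 0 ≤ Delta1r 0 s / DeltaXir n 0 (shiftr n k s) :=
    div_nonneg (Delta1r_nonneg 0 le_rfl s) (DeltaXir_nonneg n 0 le_rfl _)
  calc Delta1r 0 s * Ur n k s * uFactorr n (k μ : ℕ) (s μ) / DeltaXir n 0 (shiftr n k s)
      = Ur n k s * (uFactorr n (k μ : ℕ) (s μ) * (Delta1r 0 s / DeltaXir n 0 (shiftr n k s))) := by ring
    _ ≤ Ur n k s * (1 * 1) := by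
        apply mul_le_mul_of_nonneg_left _ hu
        exact mul_le_mul hv1 hr hr0 zero_le_one
    _ = Ur n k s := by ring

/-- (1.85) UPPER BOUND, sharp form: `Δ₀(p′)φ_μ^{(1.84)}(p′) ≤ Δ₀(p′) + a ≤ 4d + a` (`a ≥ 0`, whole Brillouin zone, every k)
— compare `B5Prop11Leaves.ineq185_upper'` (`≤ 4d + a + a·d`). [cite: Balaban1984PropagatorsI, (1.85) p.32] -/
theorem ineq185_upper_sharp (n : ℕ) [NeZero n] (hn : 1 ≤ n) (a : ℝ) (ha : 0 ≤ a) (μ : Fin d) (s : Fin d → ℝ)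
    (hs : ∀ ν, |s ν| ≤ π) :
    Delta1r 0 s * phiMu n a μ s ≤ Delta1r 0 s + a ∧ Delta1r 0 s * phiMu n a μ s ≤ 4 * d + a := by
  rw [delta1r_mul_phiMu]
  have h1 := aSym_le_one n hn s hs μ
  have h2 := Delta1r_le s
  have h3 : a * aSym n μ s ≤ a := by nlinarith
  exact ⟨by linarith, by linarith⟩

/-- `Δ(p′)` (at `l = 0`) is `≤ |p′|²`. [folklore] -/
theorem DeltaXir_le_sq (n : ℕ) (s : Fin d → ℝ) : DeltaXir n 0 s ≤ ∑ ν, s ν ^ 2 := by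
  unfold DeltaXir
  rw [add_zero]
  exact Finset.sum_le_sum fun ν _ => Sxir_le n (s ν)

/-- **Theorem A, lower half (second order at p′ = 0)**: for `p′ ≠ 0` in `[−π,π]^d`,
`1 − |p′|²/4 ≤ a_μ(p′)` with `|p′|² = Σ_ν p′_ν²`, uniformly in `n = L^k ≥ 1` and `μ`; the constant `1/4` is sharp
(`p′ ∥ e_μ`, η → 0) and independent of `d`.  Proof: keep only the `l = 0` summand, whose three factors `Δ₀/Δ(p′)`,
`|u(p′)|²`, `|v_μ(p′)|²` are each `≥ 1 − |p′|²/12` (cubic sine bound), then Weierstrass and Bernoulli. [folklore] -/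
theorem one_sub_sq_le_aSym (n : ℕ) [NeZero n] (hn : 1 ≤ n) (s : Fin d → ℝ) (hs : ∀ ν, |s ν| ≤ π)
    (ν₀ : Fin d) (hν₀ : s ν₀ ≠ 0) (μ : Fin d) : 1 - (∑ ν, s ν ^ 2) / 4 ≤ aSym n μ s := by
  set P : ℝ := ∑ ν, s ν ^ 2 with hP
  by_cases hbig : 12 ≤ P
  · have := aSym_nonneg n μ s; linarith
  have hPlt : P < 12 := not_le.mp hbig
  have hP0 : 0 ≤ P := Finset.sum_nonneg fun ν _ => sq_nonneg _
  set t : ℝ := 1 - P / 12 with ht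
  have ht0 : 0 < t := by rw [ht]; linarith
  have hF : 0 < DeltaXir n 0 s := DeltaXir_pos n hn s hs ν₀ hν₀
  have hsq : ∀ ν, s ν ^ 2 ≤ π ^ 2 := fun ν => by
    rw [← sq_abs]; exact pow_le_pow_left₀ (abs_nonneg _) (hs ν) 2
  -- factor 1: t · Δ(p′) ≤ Δ₀(p′)
  have h1 : t * DeltaXir n 0 s ≤ Delta1r 0 s := by
    unfold DeltaXir Delta1r
    rw [add_zero, add_zero, Finset.mul_sum]
    refine Finset.sum_le_sum fun ν _ => ?_
    have hν2 : s ν ^ 2 ≤ P := by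
      rw [hP]; exact Finset.single_le_sum (f := fun ν => s ν ^ 2) (fun ν _ => sq_nonneg _) (Finset.mem_univ ν)
    calc t * Sxir n (s ν) ≤ t * s ν ^ 2 := mul_le_mul_of_nonneg_left (Sxir_le n (s ν)) ht0.le
      _ ≤ s ν ^ 2 * (1 - s ν ^ 2 / 12) := by rw [ht, mul_comm]; gcongr
      _ ≤ S1r (s ν) := sq_mul_le_S1r (hs ν)
  -- factor 2: t ≤ Π_ν (1 − p_ν²/12) ≤ |u(p′)|²
  have h2 : t ≤ Ur n (fun _ => (0 : Fin n)) s := by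
    unfold Ur
    have hprod : ∏ ν, (1 - s ν ^ 2 / 12) ≤ ∏ ν, uFactorr n (((fun _ => (0 : Fin n)) ν : Fin n) : ℕ) (s ν) := by
      refine Finset.prod_le_prod (fun ν _ => ?_) (fun ν _ => ?_)
      · nlinarith [Real.pi_lt_d2, Real.pi_gt_three, hsq ν]
      · simpa using one_sub_sq_le_uFactorr_zero n hn (hs ν)
    have hW := one_sub_sum_le_prod_one_sub' (Finset.univ : Finset (Fin d)) (fun ν => s ν ^ 2 / 12)
      (fun ν _ => by positivity) (fun ν _ => by nlinarith [Real.pi_lt_d2, Real.pi_gt_three, hsq ν])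
    have : 1 - ∑ ν, s ν ^ 2 / 12 = t := by rw [ht, hP, Finset.sum_div]
    rw [this] at hW
    exact le_trans hW hprod
  -- factor 3: t ≤ 1 − p_μ²/12 ≤ |v_μ(p′)|²
  have h3 : t ≤ uFactorr n (((fun _ => (0 : Fin n)) μ : Fin n) : ℕ) (s μ) := by
    have hμ2 : s μ ^ 2 ≤ P := by
      rw [hP]; exact Finset.single_le_sum (f := fun ν => s ν ^ 2) (fun ν _ => sq_nonneg _) (Finset.mem_univ μ)
    have h := one_sub_sq_le_uFactorr_zero n hn (hs μ)
    have h' : 1 - s μ ^ 2 / 12 ≤ uFactorr n (((fun _ => (0 : Fin n)) μ : Fin n) : ℕ) (s μ) := by simpa using h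
    rw [ht]; linarith
  -- the l = 0 summand is ≥ t³
  have hsummand : t * t * t ≤ Delta1r 0 s * Ur n (fun _ => (0 : Fin n)) s
      * uFactorr n (((fun _ => (0 : Fin n)) μ : Fin n) : ℕ) (s μ) / DeltaXir n 0 (shiftr n (fun _ => (0 : Fin n)) s) := by
    rw [shiftr_zero, le_div_iff₀ hF]
    have hu0 := Ur_nonneg n (fun _ => (0 : Fin n)) s
    have hΔ0 := Delta1r_nonneg 0 le_rfl s
    calc t * t * t * DeltaXir n 0 s = (t * DeltaXir n 0 s) * t * t := by ring
      _ ≤ Delta1r 0 s * t * t := by gcongr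
      _ ≤ Delta1r 0 s * Ur n (fun _ => (0 : Fin n)) s * t :=
          mul_le_mul_of_nonneg_right (mul_le_mul_of_nonneg_left h2 hΔ0) ht0.le
      _ ≤ Delta1r 0 s * Ur n (fun _ => (0 : Fin n)) s * uFactorr n (((fun _ => (0 : Fin n)) μ : Fin n) : ℕ) (s μ) :=
          mul_le_mul_of_nonneg_left h3 (mul_nonneg hΔ0 hu0)
  have hrest : Delta1r 0 s * Ur n (fun _ => (0 : Fin n)) s
      * uFactorr n (((fun _ => (0 : Fin n)) μ : Fin n) : ℕ) (s μ) / DeltaXir n 0 (shiftr n (fun _ => (0 : Fin n)) s)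
      ≤ aSym n μ s := by
    unfold aSym
    exact Finset.single_le_sum (f := fun k : Fin d → Fin n =>
      Delta1r 0 s * Ur n k s * uFactorr n (k μ : ℕ) (s μ) / DeltaXir n 0 (shiftr n k s))
      (fun k _ => aSym_summand_nonneg n μ s k) (Finset.mem_univ _)
  -- Bernoulli: t³ ≥ 1 − 3(1 − t) = 1 − P/4
  have hbern : 1 - P / 4 ≤ t * t * t := by
    have hs : 0 ≤ (P / 12) ^ 2 * (3 - P / 12) := mul_nonneg (sq_nonneg _) (by linarith)
    rw [ht]; nlinarith [hs]
  exact le_trans hbern (le_trans hsummand hrest)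

/-- **Theorem A, lower half (global Jordan form)**: for `p′ ≠ 0` in `[−π,π]^d`, `(4/π²)^(d+2) ≤ a_μ(p′)`, uniformly in
`n ≥ 1` and `μ` — an explicit `γ₀(d)` for (1.62) p. 28 (= `B5Prop11Leaves.ineq185_lower` at `a = 1` minus `Δ₀`,
re-assembled for `a_μ`). [folklore] -/
theorem jordan_le_aSym (n : ℕ) [NeZero n] (hn : 1 ≤ n) (s : Fin d → ℝ) (hs : ∀ ν, |s ν| ≤ π)
    (ν₀ : Fin d) (hν₀ : s ν₀ ≠ 0) (μ : Fin d) : (4 / π ^ 2) ^ (d + 2) ≤ aSym n μ s := by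
  -- `B5Prop11Leaves.ineq185_lower` gives `A(4/π²)^{d+2} ≤ Δ₀ + A·a_μ` for EVERY `A ≥ 0`; if `a_μ < (4/π²)^{d+2}`,
  -- the choice `A = (Δ₀ + 1)/((4/π²)^{d+2} − a_μ)` contradicts it (the limit `A → ∞` made finite).
  by_contra hlt
  have hlt : aSym n μ s < (4 / π ^ 2) ^ (d + 2) := not_le.mp hlt
  set c : ℝ := (4 / π ^ 2) ^ (d + 2) - aSym n μ s with hc
  have hc0 : 0 < c := by rw [hc]; linarith
  set A : ℝ := (Delta1r 0 s + 1) / c with hA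
  have hA0 : 0 ≤ A := div_nonneg (by linarith [Delta1r_nonneg 0 le_rfl s]) hc0.le
  have hAl := ineq185_lower n hn A hA0 μ s hs ν₀ hν₀
  rw [delta1r_mul_phiMu] at hAl
  have hAc : A * c = Delta1r 0 s + 1 := by rw [hA]; field_simp
  have : A * (4 / π ^ 2) ^ (d + 2) - A * aSym n μ s = Delta1r 0 s + 1 := by rw [← hAc, hc]; ring
  linarith

/-- `a_μ(p′) > 0` for `p′ ≠ 0` («well-defined positive function», p. 28). [folklore] -/
theorem aSym_pos (n : ℕ) [NeZero n] (hn : 1 ≤ n) (s : Fin d → ℝ) (hs : ∀ ν, |s ν| ≤ π)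
    (ν₀ : Fin d) (hν₀ : s ν₀ ≠ 0) (μ : Fin d) : 0 < aSym n μ s :=
  lt_of_lt_of_le (by positivity) (jordan_le_aSym n hn s hs ν₀ hν₀ μ)

/-- **Theorem A (two-sided, ε-form)**: `|a_μ(p′) − 1| ≤ |p′|²/4` on `[−π,π]^d ∖ {0}`, all `n = L^k ≥ 1`
(`γ₁ = 1`; `C(d) = 1/4`, independent of `d`, sharp). [folklore] -/
theorem abs_aSym_sub_one_le (n : ℕ) [NeZero n] (hn : 1 ≤ n) (s : Fin d → ℝ) (hs : ∀ ν, |s ν| ≤ π)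
    (ν₀ : Fin d) (hν₀ : s ν₀ ≠ 0) (μ : Fin d) : |aSym n μ s - 1| ≤ (∑ ν, s ν ^ 2) / 4 := by
  have h1 := aSym_le_one n hn s hs μ
  have h2 := one_sub_sq_le_aSym n hn s hs ν₀ hν₀ μ
  rw [abs_le]; constructor <;> linarith

/-- (1.85) to second order: `|Δ₀(p′)φ_μ^{(1.84)}(p′) − (Δ₀(p′) + a)| ≤ a|p′|²/4` (`a ≥ 0`, `p′ ≠ 0`, every k) — the
printed «has a limit as p′ → 0, lim Δ₀(p′)φ_μ(p′) = a» (p. 32) with a k-uniform rate. [cite: Balaban1984PropagatorsI, (1.85) p.32] -/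
theorem abs_delta1r_mul_phiMu_sub_le (n : ℕ) [NeZero n] (hn : 1 ≤ n) (a : ℝ) (ha : 0 ≤ a) (μ : Fin d)
    (s : Fin d → ℝ) (hs : ∀ ν, |s ν| ≤ π) (ν₀ : Fin d) (hν₀ : s ν₀ ≠ 0) :
    |Delta1r 0 s * phiMu n a μ s - (Delta1r 0 s + a)| ≤ a * ((∑ ν, s ν ^ 2) / 4) := by
  rw [delta1r_mul_phiMu]
  have h := abs_aSym_sub_one_le n hn s hs ν₀ hν₀ μ
  calc |Delta1r 0 s + a * aSym n μ s - (Delta1r 0 s + a)| = |a * (aSym n μ s - 1)| := by ring_nf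
    _ = a * |aSym n μ s - 1| := by rw [abs_mul, abs_of_nonneg ha]
    _ ≤ a * ((∑ ν, s ν ^ 2) / 4) := mul_le_mul_of_nonneg_left h ha

/-! ## §3. The envelope lemma and `σ_{k,μν}(p′)` of (1.66) — Theorem B -/

/-- **Envelope lemma** (abstract): weights `w ≥ 0`, `Σ w = 1`, values `α ≤ aᵢ ≤ 1` (`α > 0`) give
`α ≤ [(Σᵢ wᵢ/aᵢ) · a_μ a_ν]⁻¹ ≤ α⁻²`. [folklore] -/
theorem inv_weighted_bounds {ι : Type*} (s : Finset ι) (w a : ι → ℝ) {α : ℝ} (hα : 0 < α)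
    (hw : ∀ i ∈ s, 0 ≤ w i) (hws : ∑ i ∈ s, w i = 1) (ha : ∀ i ∈ s, α ≤ a i ∧ a i ≤ 1)
    {μ ν : ι} (hμ : μ ∈ s) (hν : ν ∈ s) :
    α ≤ ((∑ i ∈ s, w i / a i) * (a μ * a ν))⁻¹ ∧
      ((∑ i ∈ s, w i / a i) * (a μ * a ν))⁻¹ ≤ (α ^ 2)⁻¹ := by
  have hapos : ∀ i ∈ s, 0 < a i := fun i hi => lt_of_lt_of_le hα (ha i hi).1
  have hS1 : 1 ≤ ∑ i ∈ s, w i / a i := by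
    rw [← hws]
    refine Finset.sum_le_sum fun i hi => ?_
    rw [le_div_iff₀ (hapos i hi)]
    exact mul_le_of_le_one_right (hw i hi) (ha i hi).2
  have hS2 : ∑ i ∈ s, w i / a i ≤ α⁻¹ := by
    calc ∑ i ∈ s, w i / a i ≤ ∑ i ∈ s, w i / α :=
          Finset.sum_le_sum fun i hi => div_le_div_of_nonneg_left (hw i hi) hα (ha i hi).1
      _ = (∑ i ∈ s, w i) / α := by rw [Finset.sum_div]
      _ = α⁻¹ := by rw [hws, one_div]
  have haμ := ha μ hμ
  have haν := ha ν hν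
  have haμ0 : 0 ≤ a μ := le_trans hα.le haμ.1
  have haν0 : 0 ≤ a ν := le_trans hα.le haν.1
  have hDlo : α ^ 2 ≤ (∑ i ∈ s, w i / a i) * (a μ * a ν) := by
    calc α ^ 2 = 1 * (α * α) := by ring
      _ ≤ (∑ i ∈ s, w i / a i) * (a μ * a ν) :=
          mul_le_mul hS1 (mul_le_mul haμ.1 haν.1 hα.le haμ0) (by positivity) (le_trans zero_le_one hS1)
  have hDhi : (∑ i ∈ s, w i / a i) * (a μ * a ν) ≤ α⁻¹ := by
    calc (∑ i ∈ s, w i / a i) * (a μ * a ν) ≤ α⁻¹ * (1 * 1) :=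
          mul_le_mul hS2 (mul_le_mul haμ.2 haν.2 haν0 zero_le_one) (mul_nonneg haμ0 haν0) (by positivity)
      _ = α⁻¹ := by ring
  have hDpos : 0 < (∑ i ∈ s, w i / a i) * (a μ * a ν) := lt_of_lt_of_le (by positivity) hDlo
  exact ⟨(le_inv_comm₀ hα hDpos).mpr hDhi, inv_anti₀ (by positivity) hDlo⟩

/-- from the envelope `1 − ε ≤ σ ≤ (1 − ε)⁻²` (`0 ≤ ε < 1`) to `|σ − 1| ≤ 2ε/(1 − ε)²`. [folklore] -/
theorem abs_sub_one_le_of_envelope {σ ε : ℝ} (hε0 : 0 ≤ ε) (hε1 : ε < 1) (hlo : 1 - ε ≤ σ)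
    (hhi : σ ≤ ((1 - ε) ^ 2)⁻¹) : |σ - 1| ≤ 2 * ε / (1 - ε) ^ 2 := by
  have h1 : 0 < (1 - ε) ^ 2 := by have : 0 < 1 - ε := by linarith
                                  positivity
  rw [abs_le]
  constructor
  · have h2 : ε ≤ 2 * ε / (1 - ε) ^ 2 := by
      rw [le_div_iff₀ h1]
      nlinarith [mul_nonneg hε0 hε0, mul_nonneg (mul_nonneg hε0 hε0) (by linarith : (0:ℝ) ≤ 1 - ε)]
    linarith
  · have key : 1 / (1 - ε) ^ 2 ≤ 1 + 2 * ε / (1 - ε) ^ 2 := by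
      rw [div_le_iff₀ h1, add_mul, div_mul_cancel₀ _ (ne_of_gt h1)]; nlinarith
    rw [inv_eq_one_div] at hhi
    linarith

/-- `σ_{k,μν}(p′)` of [Balaban1984PropagatorsI] (1.66) p. 29: the symbol with
`⟨B, Δ_k B⟩ = ½ Σ_{μν} (2π)^{−d} ∫ dp′ σ_{k,μν}(p′) |(∂₁B)~_{μν}(p′)|²`, namely
`σ_{k,μν} = [(Σ_λ |∂¹_λ(p′)|² / (Δ₀²(p′)φ_λ(p′))) · Δ₀(p′)φ_μ(p′) · Δ₀(p′)φ_ν(p′)]⁻¹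
          = [(Σ_λ |∂¹_λ(p′)|² / (Δ₀(p′) a_λ(p′))) · a_μ(p′) a_ν(p′)]⁻¹`, `a = Δ₀φ`;
p. 29: «The function under the integral is bounded from below and above by positive constants γ₀, γ₁ dependent
on d only», (1.67) `γ₀⟨∂₁B,∂₁B⟩ ≤ ⟨B,Δ_kB⟩ ≤ γ₁⟨∂₁B,∂₁B⟩`.
[cite: Balaban1984PropagatorsI, (1.66)–(1.67) p.29] -/
def sigmaSym (n : ℕ) [NeZero n] (μ ν : Fin d) (s : Fin d → ℝ) : ℝ :=
  ((∑ κ, S1r (s κ) / (Delta1r 0 s * aSym n κ s)) * (aSym n μ s * aSym n ν s))⁻¹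

/-- **Envelope for σ**: any uniform lower bound `0 < α ≤ a_κ(p′)` (all κ) gives `α ≤ σ_{k,μν}(p′) ≤ α⁻²`
(the weights `|∂¹_κ|²/Δ₀` sum to one — the definition of `Δ₀` — and `a ≤ 1`). [folklore] -/
theorem sigmaSym_envelope (n : ℕ) [NeZero n] (hn : 1 ≤ n) (s : Fin d → ℝ) (hs : ∀ ν, |s ν| ≤ π)
    (ν₀ : Fin d) (hν₀ : s ν₀ ≠ 0) {α : ℝ} (hα : 0 < α) (hαa : ∀ κ, α ≤ aSym n κ s) (μ ν : Fin d) :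
    α ≤ sigmaSym n μ ν s ∧ sigmaSym n μ ν s ≤ (α ^ 2)⁻¹ := by
  unfold sigmaSym
  have hl0 : 0 < Delta1r 0 s := Delta1r_pos s hs ν₀ hν₀
  simp_rw [← div_div]
  refine inv_weighted_bounds Finset.univ (fun κ => S1r (s κ) / Delta1r 0 s) (fun κ => aSym n κ s) hα
    (fun κ _ => div_nonneg (S1r_nonneg _) hl0.le) ?_ (fun κ _ => ⟨hαa κ, aSym_le_one n hn s hs κ⟩)
    (Finset.mem_univ μ) (Finset.mem_univ ν)
  rw [← Finset.sum_div]
  have : ∑ κ, S1r (s κ) = Delta1r 0 s := by unfold Delta1r; rw [add_zero]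
  rw [this]
  exact div_self (ne_of_gt hl0)

/-- **Theorem B (second order)**: for `|p′|² = Σ p′_ν² < 4`, `p′ ≠ 0`, all `μ ν` and all `n = L^k ≥ 1`,
`1 − |p′|²/4 ≤ σ_{k,μν}(p′) ≤ (1 − |p′|²/4)⁻²`, hence `|σ_{k,μν}(p′) − 1| ≤ (|p′|²/2)/(1 − |p′|²/4)²`. [folklore] -/
theorem sigmaSym_second_order (n : ℕ) [NeZero n] (hn : 1 ≤ n) (s : Fin d → ℝ) (hs : ∀ ν, |s ν| ≤ π)
    (ν₀ : Fin d) (hν₀ : s ν₀ ≠ 0) (hP : ∑ ν, s ν ^ 2 < 4) (μ ν : Fin d) :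
    1 - (∑ κ, s κ ^ 2) / 4 ≤ sigmaSym n μ ν s ∧
      sigmaSym n μ ν s ≤ ((1 - (∑ κ, s κ ^ 2) / 4) ^ 2)⁻¹ ∧
      |sigmaSym n μ ν s - 1| ≤ 2 * ((∑ κ, s κ ^ 2) / 4) / (1 - (∑ κ, s κ ^ 2) / 4) ^ 2 := by
  have hα : 0 < 1 - (∑ κ, s κ ^ 2) / 4 := by linarith
  have henv := sigmaSym_envelope n hn s hs ν₀ hν₀ hα (fun κ => one_sub_sq_le_aSym n hn s hs ν₀ hν₀ κ) μ ν
  refine ⟨henv.1, henv.2, ?_⟩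
  have hP0 : 0 ≤ (∑ κ, s κ ^ 2) / 4 := by
    have : 0 ≤ ∑ κ, s κ ^ 2 := Finset.sum_nonneg fun _ _ => sq_nonneg _
    positivity
  exact abs_sub_one_le_of_envelope (σ := sigmaSym n μ ν s) (ε := (∑ κ, s κ ^ 2) / 4) hP0 (by linarith)
    henv.1 henv.2

/-- Theorem B on the unit ball: `|p′|² ≤ 1 ⇒ |σ_{k,μν}(p′) − 1| ≤ (8/9)|p′|²`, all k. [folklore] -/
theorem abs_sigmaSym_sub_one_le (n : ℕ) [NeZero n] (hn : 1 ≤ n) (s : Fin d → ℝ) (hs : ∀ ν, |s ν| ≤ π)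
    (ν₀ : Fin d) (hν₀ : s ν₀ ≠ 0) (hP : ∑ ν, s ν ^ 2 ≤ 1) (μ ν : Fin d) :
    |sigmaSym n μ ν s - 1| ≤ 8 / 9 * ∑ κ, s κ ^ 2 := by
  have h := (sigmaSym_second_order n hn s hs ν₀ hν₀ (by linarith) μ ν).2.2
  set P := ∑ κ, s κ ^ 2 with hPdef
  have hP0 : 0 ≤ P := Finset.sum_nonneg fun _ _ => sq_nonneg _
  have hden : (9:ℝ) / 16 ≤ (1 - P / 4) ^ 2 := by nlinarith
  calc |sigmaSym n μ ν s - 1| ≤ 2 * (P / 4) / (1 - P / 4) ^ 2 := h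
    _ ≤ 2 * (P / 4) / (9 / 16) := div_le_div_of_nonneg_left (by positivity) (by norm_num) hden
    _ = 8 / 9 * P := by ring

/-- **Theorem B (global)**: explicit `γ₀(d) = (4/π²)^(d+2)`, `γ₁(d) = (π²/4)^(2d+4)` for (1.66)–(1.67):
`(4/π²)^(d+2) ≤ σ_{k,μν}(p′) ≤ ((4/π²)^(d+2))⁻²` on `[−π,π]^d ∖ {0}`, all k. [folklore] -/
theorem sigmaSym_global (n : ℕ) [NeZero n] (hn : 1 ≤ n) (s : Fin d → ℝ) (hs : ∀ ν, |s ν| ≤ π)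
    (ν₀ : Fin d) (hν₀ : s ν₀ ≠ 0) (μ ν : Fin d) :
    (4 / π ^ 2) ^ (d + 2) ≤ sigmaSym n μ ν s ∧ sigmaSym n μ ν s ≤ (((4 / π ^ 2) ^ (d + 2)) ^ 2)⁻¹ :=
  sigmaSym_envelope n hn s hs ν₀ hν₀ (by positivity) (fun κ => jordan_le_aSym n hn s hs ν₀ hν₀ κ) μ ν

/-! ## §4. Non-vacuity -/

/-- the hypotheses of Theorems A/B are satisfiable (non-vacuity, D-0026 audit): `d = 4`, `p′ = (π/2, 0, 0, 0)`.
[folklore] -/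
theorem theoremAB_nonvacuous :
    ∃ p : Fin 4 → ℝ, p 0 ≠ 0 ∧ (∀ ν, |p ν| ≤ π) ∧ ∑ ν, p ν ^ 2 < 4 := by
  refine ⟨fun ν => if ν = 0 then π / 2 else 0, ?_, ?_, ?_⟩
  · simp [Real.pi_ne_zero]
  · intro ν
    dsimp only
    split_ifs
    · rw [abs_of_nonneg (by positivity)]; linarith [Real.pi_pos]
    · simp [Real.pi_pos.le]
  · simp
    nlinarith [Real.pi_lt_four, Real.pi_pos]

/-! ## §5. Application: the hypotheses of `B5.bound145_scalar` ((1.45) p. 26, GAPS G-B5-13) over the symbols -/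

/-- `X(p′) = Σ_l |u_k(p′+l)|² Δ₀(p′)/Δ(p′+l)` of (1.45) p. 26 (the `X` of tree `B5.bound145_scalar`).
[cite: Balaban1984PropagatorsI, (1.45) p.26] -/
def X145 (n : ℕ) [NeZero n] (s : Fin d → ℝ) : ℝ :=
  ∑ k : Fin d → Fin n, Ur n k s * (Delta1r 0 s / DeltaXir n 0 (shiftr n k s))

/-- `Y(p′) = Σ_l |u_k(p′+l)|² Δ₀²(p′)/Δ²(p′+l)` of (1.45) p. 26 (the `Y` of tree `B5.bound145_scalar`).
[cite: Balaban1984PropagatorsI, (1.45) p.26] -/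
def Y145 (n : ℕ) [NeZero n] (s : Fin d → ℝ) : ℝ :=
  ∑ k : Fin d → Fin n, Ur n k s * (Delta1r 0 s / DeltaXir n 0 (shiftr n k s)) ^ 2

/-- `0 ≤ Δ₀(p′)/Δ(p′+l) ≤ 1` for every l. [folklore] -/
theorem lap_ratio_mem (n : ℕ) [NeZero n] (hn : 1 ≤ n) (s : Fin d → ℝ) (k : Fin d → Fin n) :
    0 ≤ Delta1r 0 s / DeltaXir n 0 (shiftr n k s) ∧ Delta1r 0 s / DeltaXir n 0 (shiftr n k s) ≤ 1 :=
  ⟨div_nonneg (Delta1r_nonneg 0 le_rfl s) (DeltaXir_nonneg n 0 le_rfl _),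
    div_le_one_of_le₀ (Delta1r_le_DeltaXir_shift n hn k s) (DeltaXir_nonneg n 0 le_rfl _)⟩

/-- `hYX` of `B5.bound145_scalar`: `Y ≤ X` («Δ(p′+l) ≥ Δ₀(p′) termwise»). [folklore] -/
theorem Y145_le_X145 (n : ℕ) [NeZero n] (hn : 1 ≤ n) (s : Fin d → ℝ) : Y145 n s ≤ X145 n s := by
  unfold Y145 X145
  refine Finset.sum_le_sum fun k _ => mul_le_mul_of_nonneg_left ?_ (Ur_nonneg _ _ _)
  have h := lap_ratio_mem n hn s k
  nlinarith [h.1, h.2]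

/-- `X ≤ Σ_l |u(p′+l)|² = 1`. [folklore] -/
theorem X145_le_one (n : ℕ) [NeZero n] (hn : 1 ≤ n) (s : Fin d → ℝ) (hs : ∀ ν, |s ν| ≤ π) : X145 n s ≤ 1 := by
  unfold X145
  rw [← sum_Ur_eq_one n hn s hs]
  exact Finset.sum_le_sum fun k _ => mul_le_of_le_one_right (Ur_nonneg _ _ _) (lap_ratio_mem n hn s k).2

/-- `hcX` of `B5.bound145_scalar`: `(2/π)^{2d+2} = (4/π²)^(d+1) ≤ X` for `p′ ≠ 0` (the l = 0 term). [folklore] -/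
theorem jordan_le_X145 (n : ℕ) [NeZero n] (hn : 1 ≤ n) (s : Fin d → ℝ) (hs : ∀ ν, |s ν| ≤ π)
    (ν₀ : Fin d) (hν₀ : s ν₀ ≠ 0) : (4 / π ^ 2) ^ (d + 1) ≤ X145 n s := by
  have hF : 0 < DeltaXir n 0 s := DeltaXir_pos n hn s hs ν₀ hν₀
  have h2 : (4 / π ^ 2) ^ d ≤ Ur n (fun _ => (0 : Fin n)) s := Ur_zero_ge n hn s hs
  have hr : 4 / π ^ 2 ≤ Delta1r 0 s / DeltaXir n 0 s := by
    rw [le_div_iff₀ hF]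
    have h := DeltaXir_le_Delta1r n s hs
    have hpi := Real.pi_pos
    calc 4 / π ^ 2 * DeltaXir n 0 s ≤ 4 / π ^ 2 * (π ^ 2 / 4 * Delta1r 0 s) :=
          mul_le_mul_of_nonneg_left h (by positivity)
      _ = Delta1r 0 s := by field_simp
  have hsummand : (4 / π ^ 2) ^ (d + 1)
      ≤ Ur n (fun _ => (0 : Fin n)) s * (Delta1r 0 s / DeltaXir n 0 (shiftr n (fun _ => (0 : Fin n)) s)) := by
    rw [shiftr_zero]
    calc (4 / π ^ 2) ^ (d + 1) = (4 / π ^ 2) ^ d * (4 / π ^ 2) := pow_succ _ _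
      _ ≤ Ur n (fun _ => (0 : Fin n)) s * (Delta1r 0 s / DeltaXir n 0 s) :=
          mul_le_mul h2 hr (by positivity) (Ur_nonneg _ _ _)
  unfold X145
  exact le_trans hsummand (Finset.single_le_sum (f := fun k : Fin d → Fin n =>
    Ur n k s * (Delta1r 0 s / DeltaXir n 0 (shiftr n k s)))
    (fun k _ => mul_nonneg (Ur_nonneg _ _ _) (lap_ratio_mem n hn s k).1) (Finset.mem_univ _))

/-- **G-B5-13 replacement bound, symbol-level**: for every `a > 0`, every `p′ ∈ [−π,π]^d ∖ {0}` and every k,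
`Y/(aX + Δ₀)² ≤ ((4/π²)^(d+1) a²)⁻¹ = (π/2)^{2d+2} a⁻²` — tree `B5.bound145_scalar` with both of its abstract
hypotheses discharged by `jordan_le_X145` and `Y145_le_X145`. [folklore] -/
theorem bound145_symbol (n : ℕ) [NeZero n] (hn : 1 ≤ n) (s : Fin d → ℝ) (hs : ∀ ν, |s ν| ≤ π)
    (ν₀ : Fin d) (hν₀ : s ν₀ ≠ 0) {a : ℝ} (ha : 0 < a) :
    Y145 n s / (a * X145 n s + Delta1r 0 s) ^ 2 ≤ ((4 / π ^ 2) ^ (d + 1) * a ^ 2)⁻¹ :=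
  B5.bound145_scalar a (X145 n s) (Y145 n s) (Delta1r 0 s) ((4 / π ^ 2) ^ (d + 1)) ha (by positivity)
    (jordan_le_X145 n hn s hs ν₀ hν₀) (Y145_le_X145 n hn s) (Delta1r_nonneg 0 le_rfl s)

/-- `0 ≤ Y`. [folklore] -/
theorem Y145_nonneg (n : ℕ) [NeZero n] (s : Fin d → ℝ) : 0 ≤ Y145 n s :=
  Finset.sum_nonneg fun _ _ => mul_nonneg (Ur_nonneg _ _ _) (sq_nonneg _)

/-- `(4/π²)^(d+2) ≤ Y` for `p′ ≠ 0` (the l = 0 term). [folklore] -/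
theorem jordan_le_Y145 (n : ℕ) [NeZero n] (hn : 1 ≤ n) (s : Fin d → ℝ) (hs : ∀ ν, |s ν| ≤ π)
    (ν₀ : Fin d) (hν₀ : s ν₀ ≠ 0) : (4 / π ^ 2) ^ (d + 2) ≤ Y145 n s := by
  have hF : 0 < DeltaXir n 0 s := DeltaXir_pos n hn s hs ν₀ hν₀
  have h2 : (4 / π ^ 2) ^ d ≤ Ur n (fun _ => (0 : Fin n)) s := Ur_zero_ge n hn s hs
  have hr : 4 / π ^ 2 ≤ Delta1r 0 s / DeltaXir n 0 s := by
    rw [le_div_iff₀ hF]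
    have h := DeltaXir_le_Delta1r n s hs
    calc 4 / π ^ 2 * DeltaXir n 0 s ≤ 4 / π ^ 2 * (π ^ 2 / 4 * Delta1r 0 s) :=
          mul_le_mul_of_nonneg_left h (by positivity)
      _ = Delta1r 0 s := by field_simp
  have hr2 : (4 / π ^ 2) ^ 2 ≤ (Delta1r 0 s / DeltaXir n 0 s) ^ 2 := pow_le_pow_left₀ (by positivity) hr 2
  have hsummand : (4 / π ^ 2) ^ (d + 2)
      ≤ Ur n (fun _ => (0 : Fin n)) s * (Delta1r 0 s / DeltaXir n 0 (shiftr n (fun _ => (0 : Fin n)) s)) ^ 2 := by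
    rw [shiftr_zero, pow_add]
    exact mul_le_mul h2 hr2 (by positivity) (Ur_nonneg _ _ _)
  unfold Y145
  exact le_trans hsummand (Finset.single_le_sum (f := fun k : Fin d → Fin n =>
    Ur n k s * (Delta1r 0 s / DeltaXir n 0 (shiftr n k s)) ^ 2)
    (fun k _ => mul_nonneg (Ur_nonneg _ _ _) (sq_nonneg _)) (Finset.mem_univ _))

/-- on real momenta `p′ = ofRealVec s` the LITERAL transcription `B5Strip145.m145` of the printed multiplier (1.45) is the
real number `Y/(aX + Δ₀)²`. [folklore] -/
theorem m145_ofRealVec (n : ℕ) [NeZero n] (a : ℝ) (s : Fin d → ℝ) :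
    m145 n a (ofRealVec s) = ((Y145 n s / (a * X145 n s + Delta1r 0 s) ^ 2 : ℝ) : ℂ) := by
  have hY : (∑ k : Fin d → Fin n, U n k (ofRealVec s) * (Delta1 0 (ofRealVec s)) ^ 2
      / (DeltaXi n 0 (shift n k (ofRealVec s))) ^ 2) = ((Y145 n s : ℝ) : ℂ) := by
    unfold Y145; push_cast
    refine Finset.sum_congr rfl fun k _ => ?_
    rw [U_ofReal, Delta1_ofReal, shift_ofReal, DeltaXi_ofReal]; ring
  have hX : (∑ k : Fin d → Fin n, U n k (ofRealVec s) * Delta1 0 (ofRealVec s)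
      / DeltaXi n 0 (shift n k (ofRealVec s))) = ((X145 n s : ℝ) : ℂ) := by
    unfold X145; push_cast
    refine Finset.sum_congr rfl fun k _ => ?_
    rw [U_ofReal, Delta1_ofReal, shift_ofReal, DeltaXi_ofReal]; ring
  unfold m145
  rw [hY, hX, Delta1_ofReal, inv_pow]
  push_cast
  rw [div_eq_mul_inv]

/-- the p. 26 sentence «there are positive constants γ₀, γ₁ … such that γ₀ ≦ Q′_kG′_k²Q′_k* ≦ γ₁» at SYMBOL level on the
punctured real Brillouin zone, with the PROVABLE constants (GAPS G-B5-13: the printed `γ₁ = a⁻²` fails,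
`B5.printed_gamma1_fails`): `(4/π²)^(d+2)/(a + 4d)² ≤ (1.45)(p′) ≤ (π/2)^{2d+2} a⁻²`, every `a > 0`, `p′ ≠ 0`, k
(compare the complex-strip bounds `B5Strip145.norm_mReg` with cruder constants). [folklore] -/
theorem m145_real_bounds (n : ℕ) [NeZero n] (hn : 1 ≤ n) (s : Fin d → ℝ) (hs : ∀ ν, |s ν| ≤ π)
    (ν₀ : Fin d) (hν₀ : s ν₀ ≠ 0) {a : ℝ} (ha : 0 < a) :
    (4 / π ^ 2) ^ (d + 2) / (a + 4 * d) ^ 2 ≤ ‖m145 n a (ofRealVec s)‖ ∧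
      ‖m145 n a (ofRealVec s)‖ ≤ ((4 / π ^ 2) ^ (d + 1) * a ^ 2)⁻¹ := by
  have hD0 : 0 ≤ Delta1r 0 s := Delta1r_nonneg 0 le_rfl s
  have hX0 : 0 ≤ X145 n s := le_trans (by positivity) (jordan_le_X145 n hn s hs ν₀ hν₀)
  have hval : 0 ≤ Y145 n s / (a * X145 n s + Delta1r 0 s) ^ 2 := div_nonneg (Y145_nonneg n s) (sq_nonneg _)
  rw [m145_ofRealVec, Complex.norm_real, Real.norm_eq_abs, abs_of_nonneg hval]
  refine ⟨?_, bound145_symbol n hn s hs ν₀ hν₀ ha⟩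
  have hden : (a * X145 n s + Delta1r 0 s) ^ 2 ≤ (a + 4 * d) ^ 2 := by
    have h1 : a * X145 n s ≤ a := mul_le_of_le_one_right ha.le (X145_le_one n hn s hs)
    have h2 := Delta1r_le s
    exact pow_le_pow_left₀ (by positivity) (by linarith) 2
  have hdenpos : 0 < (a * X145 n s + Delta1r 0 s) ^ 2 := by
    have : 0 < a * X145 n s + Delta1r 0 s := by
      have := mul_pos ha (lt_of_lt_of_le (by positivity) (jordan_le_X145 n hn s hs ν₀ hν₀)); linarith
    positivity
  calc (4 / π ^ 2) ^ (d + 2) / (a + 4 * d) ^ 2 ≤ (4 / π ^ 2) ^ (d + 2) / (a * X145 n s + Delta1r 0 s) ^ 2 :=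
        div_le_div_of_nonneg_left (by positivity) hdenpos hden
    _ ≤ Y145 n s / (a * X145 n s + Delta1r 0 s) ^ 2 :=
        div_le_div_of_nonneg_right (jordan_le_Y145 n hn s hs ν₀ hν₀) hdenpos.le


/-! ## §6. (v2.1) `l = 0` DOMINANCE AT FOURTH ORDER, and the Laplacian ratio `Δ₀(p′)/Δ^η(p′)` (unit lattice over η-lattice)

Every `l ≠ 0` summand of `a_μ(p′)` (1.62) carries the factor `Δ₀(p′) = O(|p′|²)` AND the weight
`|u(p′+l)|² = O(|p′|²)` against `Δ(p′+l) ≥ 4`; hence the whole alias remainder is FOURTH order, k-uniformly: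
`0 ≤ a_μ(p′) − T₀(p′) ≤ Δ₀(p′)(1 − |u(p′)|²)/4 ≤ |p′|⁴/48`, where `T₀ := Δ₀(p′)|u(p′)|²|v_μ(p′)|²/Δ^η(p′)` is the
explicit `l = 0` term (`aSymZero`): a ratio of products of one-variable trigonometric polynomials whose only
ingredient that is not smooth at `p′ = 0` is the Laplacian ratio `Δ₀(p′)/Δ^η(p′)` (unit lattice over η-lattice),
bounded here by `0 ≤ 1 − Δ₀/Δ^η ≤ (Σ_ν p′_ν⁴)/(12Δ^η(p′)) ≤ (π²/48)|p′|²` and `= 0` at `k = 0`.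
CONSEQUENCES RECORDED ON PAPER + NUMERICS ONLY (row file HOME/BETA/AN1.md §13; NOT kernel statements — they are
limits): `a_μ(p′) = 1 − [(1 − η²)/12](|p′|² + p′_μ² + Σ_ν p′_ν⁴/|p′|²) + O(|p′|⁴)`, so `a_μ` is C¹ but NOT C² at
`p′ = 0`, while in the (1.66) combination the conormal terms cancel:
`σ_{k,μν}(p′) = 1 + [(1 − η²)/12](|p′|² + p′_μ² + p′_ν²) + O(|p′|⁴)` (a polynomial germ), `η = L^{−k}`.  This is
what [Balaban1987RG1] (4.41) p. 291 «(terms of higher order in p′)» consists of at U = 1, to second relative order. -/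

/-- the `l = 0` term of `a_μ(p′)` (1.62): `T₀(p′) := Δ₀(p′)|u(p′)|²|v_μ(p′)|²/Δ^η(p′)`.
[cite: Balaban1984PropagatorsI, (1.61)–(1.62) p.28] -/
def aSymZero (n : ℕ) [NeZero n] (μ : Fin d) (s : Fin d → ℝ) : ℝ :=
  Delta1r 0 s * Ur n (fun _ => (0 : Fin n)) s * uFactorr n 0 (s μ) / DeltaXir n 0 s

/-- `T₀` is the `k = 0` summand of the sum defining `aSym`. [folklore] -/
theorem aSymZero_eq_summand (n : ℕ) [NeZero n] (μ : Fin d) (s : Fin d → ℝ) :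
    aSymZero n μ s = Delta1r 0 s * Ur n (fun _ => (0 : Fin n)) s
      * uFactorr n (((fun _ => (0 : Fin n)) μ : Fin n) : ℕ) (s μ) / DeltaXir n 0 (shiftr n (fun _ => (0 : Fin n)) s) := by
  simp [aSymZero, shiftr_zero]

/-- `0 ≤ T₀`. [folklore] -/
theorem aSymZero_nonneg (n : ℕ) [NeZero n] (μ : Fin d) (s : Fin d → ℝ) : 0 ≤ aSymZero n μ s := by
  rw [aSymZero_eq_summand]; exact aSym_summand_nonneg n μ s _

/-- `T₀ ≤ a_μ` (drop the `l ≠ 0` terms). [folklore] -/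
theorem aSymZero_le_aSym (n : ℕ) [NeZero n] (μ : Fin d) (s : Fin d → ℝ) : aSymZero n μ s ≤ aSym n μ s := by
  rw [aSymZero_eq_summand]
  unfold aSym
  exact Finset.single_le_sum (f := fun k : Fin d → Fin n =>
    Delta1r 0 s * Ur n k s * uFactorr n (k μ : ℕ) (s μ) / DeltaXir n 0 (shiftr n k s))
    (fun k _ => aSym_summand_nonneg n μ s k) (Finset.mem_univ _)

/-- **`l = 0` dominance**: `a_μ(p′) − T₀(p′) ≤ Δ₀(p′)·(1 − |u(p′)|²)/4` on `[−π,π]^d`, uniformly in `n = L^k ≥ 1`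
(termwise `|v_μ|² ≤ 1`, `Δ(p′+l) ≥ 4` for `l ≠ 0`, then the sum rule `Σ_{l≠0}|u(p′+l)|² = 1 − |u(p′)|²`). [folklore] -/
theorem aSym_sub_aSymZero_le (n : ℕ) [NeZero n] (hn : 1 ≤ n) (s : Fin d → ℝ) (hs : ∀ ν, |s ν| ≤ π) (μ : Fin d) :
    aSym n μ s - aSymZero n μ s ≤ Delta1r 0 s * (1 - Ur n (fun _ => (0 : Fin n)) s) / 4 := by
  classical
  set k0 : Fin d → Fin n := fun _ => 0 with hk0def
  set f : (Fin d → Fin n) → ℝ := fun k =>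
    Delta1r 0 s * Ur n k s * uFactorr n (k μ : ℕ) (s μ) / DeltaXir n 0 (shiftr n k s) with hf
  have hsplit : aSym n μ s = f k0 + ∑ k ∈ Finset.univ.erase k0, f k := by
    unfold aSym; rw [← Finset.add_sum_erase _ _ (Finset.mem_univ k0)]
  have hzero : f k0 = aSymZero n μ s := by rw [aSymZero_eq_summand]
  have hU : ∑ k ∈ Finset.univ.erase k0, Ur n k s = 1 - Ur n k0 s := by
    have h := Finset.add_sum_erase (Finset.univ) (fun k => Ur n k s) (Finset.mem_univ k0)
    rw [sum_Ur_eq_one n hn s hs] at h; linarith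
  have hD0 : 0 ≤ Delta1r 0 s := Delta1r_nonneg 0 le_rfl s
  have hterm : ∀ k ∈ Finset.univ.erase k0, f k ≤ Delta1r 0 s / 4 * Ur n k s := by
    intro k hk
    have hkne : k ≠ k0 := Finset.ne_of_mem_erase hk
    have h4 : 4 ≤ DeltaXir n 0 (shiftr n k s) := DeltaXir_shift_ge_four n k hkne s hs
    have hDpos : 0 < DeltaXir n 0 (shiftr n k s) := by linarith
    have hu := Ur_nonneg n k s
    have hv1 := uFactorr_le_one n hn (k μ : ℕ) (s μ)
    have hv0 := uFactorr_nonneg n (k μ : ℕ) (s μ)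
    rw [hf]; dsimp only
    rw [div_le_iff₀ hDpos]
    calc Delta1r 0 s * Ur n k s * uFactorr n (k μ : ℕ) (s μ) ≤ Delta1r 0 s * Ur n k s * 1 :=
          mul_le_mul_of_nonneg_left hv1 (mul_nonneg hD0 hu)
      _ = Delta1r 0 s / 4 * Ur n k s * 4 := by ring
      _ ≤ Delta1r 0 s / 4 * Ur n k s * DeltaXir n 0 (shiftr n k s) :=
          mul_le_mul_of_nonneg_left h4 (mul_nonneg (by positivity) hu)
  calc aSym n μ s - aSymZero n μ s = ∑ k ∈ Finset.univ.erase k0, f k := by rw [hsplit, hzero]; ring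
    _ ≤ ∑ k ∈ Finset.univ.erase k0, Delta1r 0 s / 4 * Ur n k s := Finset.sum_le_sum hterm
    _ = Delta1r 0 s / 4 * (1 - Ur n k0 s) := by rw [← Finset.mul_sum, hU]
    _ = Delta1r 0 s * (1 - Ur n k0 s) / 4 := by ring

/-- `Δ₀(p′) ≤ |p′|²`. [folklore] -/
theorem Delta1r_le_sq (s : Fin d → ℝ) : Delta1r 0 s ≤ ∑ ν, s ν ^ 2 := by
  unfold Delta1r; rw [add_zero]; exact Finset.sum_le_sum fun ν _ => S1r_le_sq (s ν)

/-- second order of the `l = 0` averaging weight: `1 − |p′|²/12 ≤ |u(p′)|² = Π_ν |v_ν(p′)|²` on `[−π,π]^d`, all k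
(one-variable bound `one_sub_sq_le_uFactorr_zero` and Weierstrass). [folklore] -/
theorem one_sub_sq_le_Ur_zero (n : ℕ) [NeZero n] (hn : 1 ≤ n) (s : Fin d → ℝ) (hs : ∀ ν, |s ν| ≤ π) :
    1 - (∑ ν, s ν ^ 2) / 12 ≤ Ur n (fun _ => (0 : Fin n)) s := by
  have hsq : ∀ ν, s ν ^ 2 ≤ π ^ 2 := fun ν => by
    rw [← sq_abs]; exact pow_le_pow_left₀ (abs_nonneg _) (hs ν) 2
  unfold Ur
  have hprod : ∏ ν, (1 - s ν ^ 2 / 12) ≤ ∏ ν, uFactorr n (((fun _ => (0 : Fin n)) ν : Fin n) : ℕ) (s ν) := by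
    refine Finset.prod_le_prod (fun ν _ => ?_) (fun ν _ => ?_)
    · nlinarith [Real.pi_lt_d2, Real.pi_gt_three, hsq ν]
    · simpa using one_sub_sq_le_uFactorr_zero n hn (hs ν)
  have hW := one_sub_sum_le_prod_one_sub' (Finset.univ : Finset (Fin d)) (fun ν => s ν ^ 2 / 12)
    (fun ν _ => by positivity) (fun ν _ => by nlinarith [Real.pi_lt_d2, Real.pi_gt_three, hsq ν])
  have : 1 - ∑ ν, s ν ^ 2 / 12 = 1 - (∑ ν, s ν ^ 2) / 12 := by rw [Finset.sum_div]
  rw [this] at hW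
  exact le_trans hW hprod

/-- **`l = 0` dominance, fourth-order form**: `0 ≤ a_μ(p′) − T₀(p′) ≤ |p′|⁴/48` on `[−π,π]^d`, uniformly in k, μ, d.
[folklore] -/
theorem aSym_sub_aSymZero_le_pow_four (n : ℕ) [NeZero n] (hn : 1 ≤ n) (s : Fin d → ℝ) (hs : ∀ ν, |s ν| ≤ π)
    (μ : Fin d) :
    0 ≤ aSym n μ s - aSymZero n μ s ∧ aSym n μ s - aSymZero n μ s ≤ (∑ ν, s ν ^ 2) ^ 2 / 48 := by
  refine ⟨by linarith [aSymZero_le_aSym n μ s], ?_⟩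
  have h1 := aSym_sub_aSymZero_le n hn s hs μ
  have h2 := Delta1r_le_sq s
  have h3 := one_sub_sq_le_Ur_zero n hn s hs
  have hD0 : 0 ≤ Delta1r 0 s := Delta1r_nonneg 0 le_rfl s
  have hU1 : 0 ≤ 1 - Ur n (fun _ => (0 : Fin n)) s := by linarith [Ur_le_one n hn (fun _ => (0 : Fin n)) s]
  have hP0 : 0 ≤ ∑ ν, s ν ^ 2 := Finset.sum_nonneg fun ν _ => sq_nonneg _
  calc aSym n μ s - aSymZero n μ s ≤ Delta1r 0 s * (1 - Ur n (fun _ => (0 : Fin n)) s) / 4 := h1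
    _ ≤ (∑ ν, s ν ^ 2) * ((∑ ν, s ν ^ 2) / 12) / 4 := by gcongr; linarith
    _ = (∑ ν, s ν ^ 2) ^ 2 / 48 := by ring

/-! ### The Laplacian ratio `Δ₀(p′)/Δ^η(p′)` (the non-smooth ingredient of `T₀`) -/

/-- `Δ₀(p′) ≤ Δ^η(p′)` (aliasing at `l = 0`), so the ratio is `≤ 1`. [folklore] -/
theorem Delta1r_le_DeltaXir_zero (n : ℕ) [NeZero n] (hn : 1 ≤ n) (s : Fin d → ℝ) :
    Delta1r 0 s ≤ DeltaXir n 0 s := by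
  simpa [shiftr_zero] using Delta1r_le_DeltaXir_shift n hn (fun _ => (0 : Fin n)) s

/-- `0 ≤ Δ^η(p′) − Δ₀(p′) ≤ (Σ_ν p′_ν⁴)/12` on `[−π,π]^d`, uniformly in η (termwise `Sxir ≤ x²`, `x²(1 − x²/12) ≤ S1r`).
[folklore] -/
theorem DeltaXir_sub_Delta1r_le (n : ℕ) [NeZero n] (hn : 1 ≤ n) (s : Fin d → ℝ) (hs : ∀ ν, |s ν| ≤ π) :
    0 ≤ DeltaXir n 0 s - Delta1r 0 s ∧ DeltaXir n 0 s - Delta1r 0 s ≤ (∑ ν, s ν ^ 4) / 12 := by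
  refine ⟨by linarith [Delta1r_le_DeltaXir_zero n hn s], ?_⟩
  unfold DeltaXir Delta1r
  rw [add_zero, add_zero, ← Finset.sum_sub_distrib, Finset.sum_div]
  refine Finset.sum_le_sum fun ν _ => ?_
  have h1 := Sxir_le n (s ν)
  have h2 := sq_mul_le_S1r (hs ν)
  nlinarith

/-- at `k = 0` (`η = 1`) the ratio is exactly `1`: `Δ^1(p′) = Δ₀(p′)`. [folklore] -/
theorem DeltaXir_one_eq_Delta1r (s : Fin d → ℝ) : DeltaXir 1 0 s = Delta1r 0 s := by
  simp [DeltaXir, Delta1r, Sxir, S1r]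

/-- Jordan lower bound `(4/π²)|p′|² ≤ Δ^η(p′)` on `[−π,π]^d`, all η. [folklore] -/
theorem jordan_sq_le_DeltaXir (n : ℕ) [NeZero n] (hn : 1 ≤ n) (s : Fin d → ℝ) (hs : ∀ ν, |s ν| ≤ π) :
    4 / π ^ 2 * ∑ ν, s ν ^ 2 ≤ DeltaXir n 0 s := by
  unfold DeltaXir
  rw [add_zero, Finset.mul_sum]
  refine Finset.sum_le_sum fun ν _ => ?_
  have h1 := S1r_ge (s ν) (hs ν)
  have h2 := S1r_le_Sxir n hn (s ν)
  calc 4 / π ^ 2 * s ν ^ 2 = 4 * s ν ^ 2 / π ^ 2 := by ring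
    _ ≤ Sxir n (s ν) := le_trans h1 h2

/-- **the non-smooth ingredient is second-order small**: for `p′ ≠ 0` in `[−π,π]^d`,
`0 ≤ 1 − Δ₀(p′)/Δ^η(p′) ≤ (Σ_ν p′_ν⁴)/(12 Δ^η(p′)) ≤ (π²/48)|p′|²`, uniformly in η = L^{−k}.  (Paper: the exact
germ is `(1 − η²)(Σ_ν p′_ν⁴)/(12|p′|²)`, homogeneous of degree 2 but not a polynomial — AN1.md §13.) [folklore] -/
theorem one_sub_lapRatio_bounds (n : ℕ) [NeZero n] (hn : 1 ≤ n) (s : Fin d → ℝ) (hs : ∀ ν, |s ν| ≤ π)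
    (ν₀ : Fin d) (hν₀ : s ν₀ ≠ 0) :
    0 ≤ 1 - Delta1r 0 s / DeltaXir n 0 s ∧
      1 - Delta1r 0 s / DeltaXir n 0 s ≤ (∑ ν, s ν ^ 4) / (12 * DeltaXir n 0 s) ∧
      1 - Delta1r 0 s / DeltaXir n 0 s ≤ π ^ 2 / 48 * ∑ ν, s ν ^ 2 := by
  have hF : 0 < DeltaXir n 0 s := DeltaXir_pos n hn s hs ν₀ hν₀
  have hle := Delta1r_le_DeltaXir_zero n hn s
  obtain ⟨_, hdiff⟩ := DeltaXir_sub_Delta1r_le n hn s hs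
  have hJ := jordan_sq_le_DeltaXir n hn s hs
  have hP0 : 0 < ∑ ν, s ν ^ 2 := by
    have := Finset.single_le_sum (f := fun ν => s ν ^ 2) (fun ν _ => sq_nonneg _) (Finset.mem_univ ν₀)
    have h0 : 0 < s ν₀ ^ 2 := by positivity
    linarith
  have e1 : 1 - Delta1r 0 s / DeltaXir n 0 s = (DeltaXir n 0 s - Delta1r 0 s) / DeltaXir n 0 s := by
    field_simp
  refine ⟨?_, ?_, ?_⟩
  · rw [e1]; exact div_nonneg (by linarith) hF.le
  · rw [e1, div_le_div_iff₀ hF (by positivity)]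
    calc (DeltaXir n 0 s - Delta1r 0 s) * (12 * DeltaXir n 0 s)
        = 12 * (DeltaXir n 0 s - Delta1r 0 s) * DeltaXir n 0 s := by ring
      _ ≤ (∑ ν, s ν ^ 4) * DeltaXir n 0 s := by
          apply mul_le_mul_of_nonneg_right _ hF.le; linarith
  · -- Σ p⁴ ≤ (Σ p²)·(Σ p²) and Δ^η ≥ (4/π²) Σ p²
    have h4 : ∑ ν, s ν ^ 4 ≤ (∑ ν, s ν ^ 2) * ∑ ν, s ν ^ 2 := by
      rw [Finset.mul_sum]
      refine Finset.sum_le_sum fun ν _ => ?_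
      have hν : s ν ^ 2 ≤ ∑ κ, s κ ^ 2 :=
        Finset.single_le_sum (f := fun κ => s κ ^ 2) (fun κ _ => sq_nonneg _) (Finset.mem_univ ν)
      calc s ν ^ 4 = s ν ^ 2 * s ν ^ 2 := by ring
        _ ≤ (∑ κ, s κ ^ 2) * s ν ^ 2 := mul_le_mul_of_nonneg_right hν (sq_nonneg _)
    rw [e1, div_le_iff₀ hF]
    have hπ : 0 < π ^ 2 := by positivity
    calc DeltaXir n 0 s - Delta1r 0 s ≤ (∑ ν, s ν ^ 4) / 12 := hdiff
      _ ≤ (∑ ν, s ν ^ 2) * (∑ ν, s ν ^ 2) / 12 := by gcongr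
      _ = π ^ 2 / 48 * (∑ ν, s ν ^ 2) * (4 / π ^ 2 * ∑ ν, s ν ^ 2) := by field_simp; ring
      _ ≤ π ^ 2 / 48 * (∑ ν, s ν ^ 2) * DeltaXir n 0 s :=
          mul_le_mul_of_nonneg_left hJ (by positivity)

/-- the `l = 0` term in closed form as a product of three factors each in `[1 − O(|p′|²), 1]`:
`T₀ = |u(p′)|² · |v_μ(p′)|² · (Δ₀(p′)/Δ^η(p′))`. [folklore] -/
theorem aSymZero_eq_prod (n : ℕ) [NeZero n] (μ : Fin d) (s : Fin d → ℝ) :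
    aSymZero n μ s = Ur n (fun _ => (0 : Fin n)) s * uFactorr n 0 (s μ) * (Delta1r 0 s / DeltaXir n 0 s) := by
  unfold aSymZero; ring

/-- **second-order envelope of `T₀`**: `1 − |p′|²/12 − p′_μ²/12 − (π²/48)|p′|² ≤ T₀(p′) ≤ 1` for `p′ ≠ 0` in
`[−π,π]^d`, uniformly in k (Weierstrass on the three factors).  Together with `aSym_sub_aSymZero_le_pow_four` this
re-proves Theorem A's second order with the structure exposed: all of `1 − a_μ` to second order sits in `T₀`.
[folklore] -/
theorem aSymZero_envelope (n : ℕ) [NeZero n] (hn : 1 ≤ n) (s : Fin d → ℝ) (hs : ∀ ν, |s ν| ≤ π)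
    (ν₀ : Fin d) (hν₀ : s ν₀ ≠ 0) (μ : Fin d) :
    1 - ((∑ ν, s ν ^ 2) / 12 + s μ ^ 2 / 12 + π ^ 2 / 48 * ∑ ν, s ν ^ 2) ≤ aSymZero n μ s ∧ aSymZero n μ s ≤ 1 := by
  rw [aSymZero_eq_prod]
  set A := Ur n (fun _ => (0 : Fin n)) s
  set B := uFactorr n 0 (s μ)
  set C := Delta1r 0 s / DeltaXir n 0 s
  have hF : 0 < DeltaXir n 0 s := DeltaXir_pos n hn s hs ν₀ hν₀
  have hA1 : A ≤ 1 := Ur_le_one n hn _ s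
  have hA0 : 0 ≤ A := Ur_nonneg n _ s
  have hB1 : B ≤ 1 := uFactorr_le_one n hn 0 (s μ)
  have hB0 : 0 ≤ B := uFactorr_nonneg n 0 (s μ)
  have hC1 : C ≤ 1 := div_le_one_of_le₀ (Delta1r_le_DeltaXir_zero n hn s) hF.le
  have hC0 : 0 ≤ C := div_nonneg (Delta1r_nonneg 0 le_rfl s) hF.le
  have hAl : 1 - (∑ ν, s ν ^ 2) / 12 ≤ A := one_sub_sq_le_Ur_zero n hn s hs
  have hBl : 1 - s μ ^ 2 / 12 ≤ B := one_sub_sq_le_uFactorr_zero n hn (hs μ)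
  have hCl : 1 - π ^ 2 / 48 * ∑ ν, s ν ^ 2 ≤ C := by
    have := (one_sub_lapRatio_bounds n hn s hs ν₀ hν₀).2.2; linarith
  refine ⟨?_, ?_⟩
  · -- Weierstrass for three factors: (1-a)(1-b)(1-c) ≥ 1 - a - b - c when the factors are in [0,1]
    have key : ∀ a b c A B C : ℝ, 0 ≤ A → A ≤ 1 → 0 ≤ B → B ≤ 1 → 0 ≤ C → C ≤ 1 →
        1 - a ≤ A → 1 - b ≤ B → 1 - c ≤ C → 1 - (a + b + c) ≤ A * B * C := by
      intro a b c A B C hA0 hA1 hB0 hB1 hC0 hC1 ha hb hc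
      have h1 : 1 - (a + b) ≤ A * B := by nlinarith
      nlinarith
    exact key _ _ _ A B C hA0 hA1 hB0 hB1 hC0 hC1 hAl hBl hCl
  · calc A * B * C ≤ 1 * 1 * 1 := by gcongr
      _ = 1 := by ring

/-! ## §7. (v2.2) EXACT FACTORISATION of `σ_{k,μν}` (1.66): the Laplacian ratio cancels -/

/-- `F_k(p′) := 1/(|u(p′)|²|v_μ(p′)|²|v_ν(p′)|²)` — the value of `σ_{k,μν}` (1.66) when every `a_λ` is replaced by its
`l = 0` term `T₀,λ` (see `sigmaSym_factorisation`); a product of the printed one-variable function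
`1/|v(s)|² = L^{2k} sin²(s/2L^k)/sin²(s/2)` of (1.61). [cite: Balaban1984PropagatorsI, (1.61) p.28, (1.66) p.29] -/
def Fk (n : ℕ) [NeZero n] (μ ν : Fin d) (s : Fin d → ℝ) : ℝ :=
  (Ur n (fun _ => (0 : Fin n)) s * uFactorr n 0 (s μ) * uFactorr n 0 (s ν))⁻¹

/-- the ALIAS RATIO `t_λ(p′) := a_λ(p′)/T₀,λ(p′)` (`= 1 +` the `l ≠ 0` part of (1.62) relative to the `l = 0` term). [folklore] -/
def tRatio (n : ℕ) [NeZero n] (κ : Fin d) (s : Fin d → ℝ) : ℝ := aSym n κ s / aSymZero n κ s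

/-- the PARTITION WEIGHTS `ω_λ(p′) := Δ^η_λ(p′_λ)/Δ^η(p′)` (`Δ^η_λ(s) = L^{2k}·4sin²(s/2L^k)`, `Δ^η = Σ_λ Δ^η_λ`). [folklore] -/
def omegaW (n : ℕ) (κ : Fin d) (s : Fin d → ℝ) : ℝ := Sxir n (s κ) / DeltaXir n 0 s

/-- `|∂¹(s)|² = Δ^η_λ(s)·|v(s)|²` on `[−π, π]`: the identity behind the cancellation (both sides vanish at `s = 0`). [folklore] -/
theorem S1r_eq_Sxir_mul_uFactorr_zero (n : ℕ) (hn : 1 ≤ n) {x : ℝ} (hx : |x| ≤ π) :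
    S1r x = Sxir n x * uFactorr n 0 x := by
  rw [uFactorr, if_pos rfl]
  split_ifs with h0
  · rw [h0]; simp [S1r, Sxir]
  · have hX : Sxir n x ≠ 0 := ne_of_gt (Sxir_pos n hn x h0 hx)
    field_simp

/-- `0 < |v(s)|²` on `[−π, π]`. [folklore] -/
theorem uFactorr_zero_pos (n : ℕ) (hn : 1 ≤ n) {x : ℝ} (hx : |x| ≤ π) : 0 < uFactorr n 0 x :=
  lt_of_lt_of_le (by positivity) (uFactorr_zero_ge n hn x hx)

/-- `0 < |u(p′)|²` on the zone. [folklore] -/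
theorem Ur_zero_pos (n : ℕ) [NeZero n] (hn : 1 ≤ n) (s : Fin d → ℝ) (hs : ∀ ν, |s ν| ≤ π) :
    0 < Ur n (fun _ => (0 : Fin n)) s :=
  lt_of_lt_of_le (by positivity) (Ur_zero_ge n hn s hs)

/-- `0 < T₀` on the punctured zone. [folklore] -/
theorem aSymZero_pos (n : ℕ) [NeZero n] (hn : 1 ≤ n) (s : Fin d → ℝ) (hs : ∀ ν, |s ν| ≤ π)
    (ν₀ : Fin d) (hν₀ : s ν₀ ≠ 0) (μ : Fin d) : 0 < aSymZero n μ s := by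
  unfold aSymZero
  exact div_pos (mul_pos (mul_pos (Delta1r_pos s hs ν₀ hν₀) (Ur_zero_pos n hn s hs))
    (uFactorr_zero_pos n hn (hs μ))) (DeltaXir_pos n hn s hs ν₀ hν₀)

/-- `0 < F_k`. [folklore] -/
theorem Fk_pos (n : ℕ) [NeZero n] (hn : 1 ≤ n) (s : Fin d → ℝ) (hs : ∀ ν, |s ν| ≤ π) (μ ν : Fin d) :
    0 < Fk n μ ν s := by
  unfold Fk
  exact inv_pos.mpr (mul_pos (mul_pos (Ur_zero_pos n hn s hs) (uFactorr_zero_pos n hn (hs μ)))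
    (uFactorr_zero_pos n hn (hs ν)))

/-- `1 ≤ t_λ` (drop the `l ≠ 0` terms). [folklore] -/
theorem one_le_tRatio (n : ℕ) [NeZero n] (hn : 1 ≤ n) (s : Fin d → ℝ) (hs : ∀ ν, |s ν| ≤ π)
    (ν₀ : Fin d) (hν₀ : s ν₀ ≠ 0) (κ : Fin d) : 1 ≤ tRatio n κ s := by
  unfold tRatio
  rw [le_div_iff₀ (aSymZero_pos n hn s hs ν₀ hν₀ κ), one_mul]
  exact aSymZero_le_aSym n κ s

/-- `0 < t_λ`. [folklore] -/
theorem tRatio_pos (n : ℕ) [NeZero n] (hn : 1 ≤ n) (s : Fin d → ℝ) (hs : ∀ ν, |s ν| ≤ π)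
    (ν₀ : Fin d) (hν₀ : s ν₀ ≠ 0) (κ : Fin d) : 0 < tRatio n κ s :=
  lt_of_lt_of_le one_pos (one_le_tRatio n hn s hs ν₀ hν₀ κ)

/-- `ω_λ ≥ 0`. [folklore] -/
theorem omegaW_nonneg (n : ℕ) (κ : Fin d) (s : Fin d → ℝ) : 0 ≤ omegaW n κ s :=
  div_nonneg (Sxir_nonneg _ _) (DeltaXir_nonneg n 0 le_rfl s)

/-- `Σ_λ ω_λ = 1` on the punctured zone. [folklore] -/
theorem sum_omegaW_eq_one (n : ℕ) (hn : 1 ≤ n) (s : Fin d → ℝ) (hs : ∀ ν, |s ν| ≤ π)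
    (ν₀ : Fin d) (hν₀ : s ν₀ ≠ 0) : ∑ κ, omegaW n κ s = 1 := by
  unfold omegaW
  rw [← Finset.sum_div]
  have h : ∑ κ, Sxir n (s κ) = DeltaXir n 0 s := by unfold DeltaXir; rw [add_zero]
  rw [h]
  exact div_self (ne_of_gt (DeltaXir_pos n hn s hs ν₀ hν₀))

/-- the TERMWISE identity: `|∂¹_λ|²/(Δ₀ a_λ) = [(Δ^η)²/(Δ₀²|u(p′)|²)] · ω_λ/t_λ`. [folklore] -/
theorem weight_div_aSym_eq (n : ℕ) [NeZero n] (hn : 1 ≤ n) (s : Fin d → ℝ) (hs : ∀ ν, |s ν| ≤ π)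
    (ν₀ : Fin d) (hν₀ : s ν₀ ≠ 0) (κ : Fin d) :
    S1r (s κ) / (Delta1r 0 s * aSym n κ s)
      = DeltaXir n 0 s ^ 2 / (Delta1r 0 s ^ 2 * Ur n (fun _ => (0 : Fin n)) s) * (omegaW n κ s / tRatio n κ s) := by
  have hD0 : Delta1r 0 s ≠ 0 := ne_of_gt (Delta1r_pos s hs ν₀ hν₀)
  have hDx : DeltaXir n 0 s ≠ 0 := ne_of_gt (DeltaXir_pos n hn s hs ν₀ hν₀)
  have hU : Ur n (fun _ => (0 : Fin n)) s ≠ 0 := ne_of_gt (Ur_zero_pos n hn s hs)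
  have huf : uFactorr n 0 (s κ) ≠ 0 := ne_of_gt (uFactorr_zero_pos n hn (hs κ))
  have hA : aSym n κ s ≠ 0 := ne_of_gt (aSym_pos n hn s hs ν₀ hν₀ κ)
  unfold omegaW tRatio aSymZero
  rw [S1r_eq_Sxir_mul_uFactorr_zero n hn (hs κ)]
  field_simp

/-- `a_λ = T₀,λ · t_λ`. [folklore] -/
theorem aSym_eq_aSymZero_mul_tRatio (n : ℕ) [NeZero n] (hn : 1 ≤ n) (s : Fin d → ℝ) (hs : ∀ ν, |s ν| ≤ π)
    (ν₀ : Fin d) (hν₀ : s ν₀ ≠ 0) (κ : Fin d) : aSym n κ s = aSymZero n κ s * tRatio n κ s := by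
  unfold tRatio
  rw [mul_div_cancel₀ _ (ne_of_gt (aSymZero_pos n hn s hs ν₀ hν₀ κ))]

/-- **EXACT FACTORISATION of `σ_{k,μν}` (1.66) at `U = 1`**: on the punctured zone, for all `k` (`n = L^k ≥ 1`),
`σ_{k,μν}(p′) = F_k(p′) · [t_μ t_ν Σ_λ ω_λ/t_λ]⁻¹` with `F_k = 1/(|u(p′)|²|v_μ|²|v_ν|²)` explicit, `ω_λ = Δ^η_λ/Δ^η`,
`t_λ = a_λ/T₀,λ`.  The Laplacian ratio `Δ₀/Δ^η` of `T₀` (the non-C² ingredient of `a_μ`, §6) CANCELS identically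
between the `a_λ` and the transverse weights `|∂¹_λ|²/Δ₀`, because `|∂¹_λ|² = Δ^η_λ|v_λ|²`. [folklore] -/
theorem sigmaSym_factorisation (n : ℕ) [NeZero n] (hn : 1 ≤ n) (s : Fin d → ℝ) (hs : ∀ ν, |s ν| ≤ π)
    (ν₀ : Fin d) (hν₀ : s ν₀ ≠ 0) (μ ν : Fin d) :
    sigmaSym n μ ν s
      = Fk n μ ν s * (tRatio n μ s * tRatio n ν s * ∑ κ, omegaW n κ s / tRatio n κ s)⁻¹ := by
  have hD0 : Delta1r 0 s ≠ 0 := ne_of_gt (Delta1r_pos s hs ν₀ hν₀)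
  have hDx : DeltaXir n 0 s ≠ 0 := ne_of_gt (DeltaXir_pos n hn s hs ν₀ hν₀)
  have hU : Ur n (fun _ => (0 : Fin n)) s ≠ 0 := ne_of_gt (Ur_zero_pos n hn s hs)
  set W := ∑ κ, omegaW n κ s / tRatio n κ s with hW
  have hQ : ∑ κ, S1r (s κ) / (Delta1r 0 s * aSym n κ s)
      = DeltaXir n 0 s ^ 2 / (Delta1r 0 s ^ 2 * Ur n (fun _ => (0 : Fin n)) s) * W := by
    rw [hW, Finset.mul_sum]
    exact Finset.sum_congr rfl fun κ _ => weight_div_aSym_eq n hn s hs ν₀ hν₀ κ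
  unfold sigmaSym Fk
  rw [hQ, aSym_eq_aSymZero_mul_tRatio n hn s hs ν₀ hν₀ μ, aSym_eq_aSymZero_mul_tRatio n hn s hs ν₀ hν₀ ν,
    aSymZero_eq_prod, aSymZero_eq_prod, ← mul_inv]
  congr 1
  field_simp

/-- bounds on the bracket: `1 ≤ t_λ ≤ 1 + e` (all λ) gives `(1+e)⁻¹ ≤ t_μ t_ν Σ_λ ω_λ/t_λ ≤ (1+e)²`. [folklore] -/
theorem bracket_bounds (n : ℕ) [NeZero n] (hn : 1 ≤ n) (s : Fin d → ℝ) (hs : ∀ ν, |s ν| ≤ π)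
    (ν₀ : Fin d) (hν₀ : s ν₀ ≠ 0) {e : ℝ} (he : 0 ≤ e) (ht : ∀ κ, tRatio n κ s ≤ 1 + e) (μ ν : Fin d) :
    (1 + e)⁻¹ ≤ tRatio n μ s * tRatio n ν s * ∑ κ, omegaW n κ s / tRatio n κ s ∧
      tRatio n μ s * tRatio n ν s * ∑ κ, omegaW n κ s / tRatio n κ s ≤ (1 + e) ^ 2 := by
  have h1 := one_le_tRatio n hn s hs ν₀ hν₀
  have hω := sum_omegaW_eq_one n hn s hs ν₀ hν₀
  have hSle : ∑ κ, omegaW n κ s / tRatio n κ s ≤ 1 := by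
    rw [← hω]
    exact Finset.sum_le_sum fun κ _ => div_le_self (omegaW_nonneg n κ s) (h1 κ)
  have hSge : (1 + e)⁻¹ ≤ ∑ κ, omegaW n κ s / tRatio n κ s := by
    have : (1 + e)⁻¹ = ∑ κ, omegaW n κ s / (1 + e) := by rw [← Finset.sum_div, hω, one_div]
    rw [this]
    exact Finset.sum_le_sum fun κ _ =>
      div_le_div_of_nonneg_left (omegaW_nonneg n κ s) (tRatio_pos n hn s hs ν₀ hν₀ κ) (ht κ)
  have hS0 : 0 ≤ ∑ κ, omegaW n κ s / tRatio n κ s :=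
    Finset.sum_nonneg fun κ _ => div_nonneg (omegaW_nonneg n κ s) (tRatio_pos n hn s hs ν₀ hν₀ κ).le
  have htt : 1 ≤ tRatio n μ s * tRatio n ν s := one_le_mul_of_one_le_of_one_le (h1 μ) (h1 ν)
  constructor
  · calc (1 + e)⁻¹ ≤ ∑ κ, omegaW n κ s / tRatio n κ s := hSge
      _ = 1 * ∑ κ, omegaW n κ s / tRatio n κ s := (one_mul _).symm
      _ ≤ tRatio n μ s * tRatio n ν s * ∑ κ, omegaW n κ s / tRatio n κ s :=
          mul_le_mul_of_nonneg_right htt hS0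
  · calc tRatio n μ s * tRatio n ν s * ∑ κ, omegaW n κ s / tRatio n κ s
        ≤ (1 + e) * (1 + e) * 1 := by
          apply mul_le_mul (mul_le_mul (ht μ) (ht ν) (by linarith [h1 ν]) (by linarith)) hSle hS0
          positivity
      _ = (1 + e) ^ 2 := by ring

/-- the alias ratio to fourth order: `t_λ − 1 ≤ Δ^η(1 − |u(p′)|²)/(4|u(p′)|²|v_λ|²)`. [folklore] -/
theorem tRatio_sub_one_le (n : ℕ) [NeZero n] (hn : 1 ≤ n) (s : Fin d → ℝ) (hs : ∀ ν, |s ν| ≤ π)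
    (ν₀ : Fin d) (hν₀ : s ν₀ ≠ 0) (κ : Fin d) :
    tRatio n κ s - 1 ≤ DeltaXir n 0 s * (1 - Ur n (fun _ => (0 : Fin n)) s)
        / (4 * (Ur n (fun _ => (0 : Fin n)) s * uFactorr n 0 (s κ))) := by
  have hZ := aSymZero_pos n hn s hs ν₀ hν₀ κ
  have hD0 : 0 < Delta1r 0 s := Delta1r_pos s hs ν₀ hν₀
  have hDx : 0 < DeltaXir n 0 s := DeltaXir_pos n hn s hs ν₀ hν₀
  have hU : 0 < Ur n (fun _ => (0 : Fin n)) s := Ur_zero_pos n hn s hs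
  have huf : 0 < uFactorr n 0 (s κ) := uFactorr_zero_pos n hn (hs κ)
  have hsub := aSym_sub_aSymZero_le n hn s hs κ
  have h1 : tRatio n κ s - 1 = (aSym n κ s - aSymZero n κ s) / aSymZero n κ s := by
    unfold tRatio; field_simp
  rw [h1]
  calc (aSym n κ s - aSymZero n κ s) / aSymZero n κ s
      ≤ (Delta1r 0 s * (1 - Ur n (fun _ => (0 : Fin n)) s) / 4) / aSymZero n κ s :=
        div_le_div_of_nonneg_right hsub hZ.le
    _ = DeltaXir n 0 s * (1 - Ur n (fun _ => (0 : Fin n)) s)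
        / (4 * (Ur n (fun _ => (0 : Fin n)) s * uFactorr n 0 (s κ))) := by
        unfold aSymZero
        field_simp

/-- … and with d-only constants: `t_λ − 1 ≤ |p′|⁴/(48·(4/π²)^(d+1))`, uniformly in `k`. [folklore] -/
theorem tRatio_sub_one_le' (n : ℕ) [NeZero n] (hn : 1 ≤ n) (s : Fin d → ℝ) (hs : ∀ ν, |s ν| ≤ π)
    (ν₀ : Fin d) (hν₀ : s ν₀ ≠ 0) (κ : Fin d) :
    tRatio n κ s - 1 ≤ (∑ ν, s ν ^ 2) ^ 2 / (48 * (4 / π ^ 2) ^ (d + 1)) := by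
  have h := tRatio_sub_one_le n hn s hs ν₀ hν₀ κ
  have hU : 0 < Ur n (fun _ => (0 : Fin n)) s := Ur_zero_pos n hn s hs
  have huf : 0 < uFactorr n 0 (s κ) := uFactorr_zero_pos n hn (hs κ)
  have hUge := Ur_zero_ge n hn s hs
  have hufge := uFactorr_zero_ge n hn (s κ) (hs κ)
  have hDx : DeltaXir n 0 s ≤ ∑ ν, s ν ^ 2 := DeltaXir_le_sq n s
  have h1U : 1 - Ur n (fun _ => (0 : Fin n)) s ≤ (∑ ν, s ν ^ 2) / 12 := by
    linarith [one_sub_sq_le_Ur_zero n hn s hs]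
  have hc : 0 < (4 / π ^ 2 : ℝ) ^ (d + 1) := by positivity
  have hprod : (4 / π ^ 2 : ℝ) ^ (d + 1) ≤ Ur n (fun _ => (0 : Fin n)) s * uFactorr n 0 (s κ) := by
    rw [pow_succ]
    exact mul_le_mul hUge hufge (by positivity) hU.le
  have hS : 0 ≤ ∑ ν, s ν ^ 2 := Finset.sum_nonneg fun ν _ => sq_nonneg _
  have hDx0 : 0 ≤ DeltaXir n 0 s := DeltaXir_nonneg n 0 le_rfl s
  have h1U0 : 0 ≤ 1 - Ur n (fun _ => (0 : Fin n)) s := by linarith [Ur_le_one n hn (fun _ => (0 : Fin n)) s]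
  calc tRatio n κ s - 1
      ≤ DeltaXir n 0 s * (1 - Ur n (fun _ => (0 : Fin n)) s)
          / (4 * (Ur n (fun _ => (0 : Fin n)) s * uFactorr n 0 (s κ))) := h
    _ ≤ ((∑ ν, s ν ^ 2) * ((∑ ν, s ν ^ 2) / 12)) / (4 * (4 / π ^ 2) ^ (d + 1)) := by
        apply div_le_div₀ (by positivity) (mul_le_mul hDx h1U h1U0 hS) (by positivity)
        exact mul_le_mul_of_nonneg_left hprod (by norm_num)
    _ = (∑ ν, s ν ^ 2) ^ 2 / (48 * (4 / π ^ 2) ^ (d + 1)) := by ring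

/-- **COROLLARY (`σ_k = F_k · (1 + O(|p′|⁴))`, two-sided, k-uniform)**: with `e := |p′|⁴/(48(4/π²)^(d+1))`,
`F_k/(1+e)² ≤ σ_{k,μν} ≤ F_k·(1+e)` on the punctured zone, for every `k`. [folklore] -/
theorem sigmaSym_Fk_bounds (n : ℕ) [NeZero n] (hn : 1 ≤ n) (s : Fin d → ℝ) (hs : ∀ ν, |s ν| ≤ π)
    (ν₀ : Fin d) (hν₀ : s ν₀ ≠ 0) (μ ν : Fin d) :
    Fk n μ ν s / (1 + (∑ κ, s κ ^ 2) ^ 2 / (48 * (4 / π ^ 2) ^ (d + 1))) ^ 2 ≤ sigmaSym n μ ν s ∧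
      sigmaSym n μ ν s ≤ Fk n μ ν s * (1 + (∑ κ, s κ ^ 2) ^ 2 / (48 * (4 / π ^ 2) ^ (d + 1))) := by
  set e := (∑ κ, s κ ^ 2) ^ 2 / (48 * (4 / π ^ 2) ^ (d + 1)) with he_def
  have he : 0 ≤ e := by positivity
  have ht : ∀ κ, tRatio n κ s ≤ 1 + e := fun κ => by linarith [tRatio_sub_one_le' n hn s hs ν₀ hν₀ κ]
  obtain ⟨hlo, hhi⟩ := bracket_bounds n hn s hs ν₀ hν₀ he ht μ ν
  have hF := Fk_pos n hn s hs μ ν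
  set X := tRatio n μ s * tRatio n ν s * ∑ κ, omegaW n κ s / tRatio n κ s with hX
  have hX0 : 0 < X := lt_of_lt_of_le (by positivity) hlo
  rw [sigmaSym_factorisation n hn s hs ν₀ hν₀ μ ν, ← hX]
  constructor
  · rw [div_eq_mul_inv]
    exact mul_le_mul_of_nonneg_left ((inv_le_inv₀ (by positivity) hX0).mpr hhi) hF.le
  · have : X⁻¹ ≤ 1 + e := by
      rw [inv_le_comm₀ hX0 (by positivity)]; exact hlo
    exact mul_le_mul_of_nonneg_left this hF.le

/-- `1 ≤ F_k` (each factor of `|u|²|v_μ|²|v_ν|²` is `≤ 1`). [folklore] -/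
theorem one_le_Fk (n : ℕ) [NeZero n] (hn : 1 ≤ n) (s : Fin d → ℝ) (hs : ∀ ν, |s ν| ≤ π) (μ ν : Fin d) :
    1 ≤ Fk n μ ν s := by
  unfold Fk
  have hU : 0 < Ur n (fun _ => (0 : Fin n)) s := Ur_zero_pos n hn s hs
  have h1 := uFactorr_zero_pos n hn (hs μ)
  have h2 := uFactorr_zero_pos n hn (hs ν)
  rw [one_le_inv₀ (by positivity)]
  calc Ur n (fun _ => (0 : Fin n)) s * uFactorr n 0 (s μ) * uFactorr n 0 (s ν) ≤ 1 * 1 * 1 := by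
        apply mul_le_mul (mul_le_mul (Ur_le_one n hn _ s) (uFactorr_le_one n hn 0 _) h1.le zero_le_one)
          (uFactorr_le_one n hn 0 _) h2.le (by positivity)
    _ = 1 := by ring

/-- global: `F_k ≤ (π²/4)^(d+2)`. [folklore] -/
theorem Fk_le_global (n : ℕ) [NeZero n] (hn : 1 ≤ n) (s : Fin d → ℝ) (hs : ∀ ν, |s ν| ≤ π) (μ ν : Fin d) :
    Fk n μ ν s ≤ (π ^ 2 / 4) ^ (d + 2) := by
  unfold Fk
  have hc : 0 < (4 / π ^ 2 : ℝ) := by positivity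
  have hprod : (4 / π ^ 2 : ℝ) ^ (d + 2) ≤ Ur n (fun _ => (0 : Fin n)) s * uFactorr n 0 (s μ) * uFactorr n 0 (s ν) := by
    rw [pow_succ, pow_succ]
    exact mul_le_mul (mul_le_mul (Ur_zero_ge n hn s hs) (uFactorr_zero_ge n hn (s μ) (hs μ)) hc.le
      (Ur_zero_pos n hn s hs).le) (uFactorr_zero_ge n hn (s ν) (hs ν)) hc.le
      (mul_nonneg (Ur_nonneg _ _ _) (uFactorr_nonneg _ _ _))
  have : (π ^ 2 / 4 : ℝ) ^ (d + 2) = ((4 / π ^ 2) ^ (d + 2))⁻¹ := by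
    rw [← inv_pow]; congr 1; field_simp
  rw [this]
  exact (inv_le_inv₀ (lt_of_lt_of_le (by positivity) hprod) (by positivity)).mpr hprod

/-- local (second order): for `|p′|² < 12`, `F_k ≤ [(1 − |p′|²/12)(1 − p′_μ²/12)(1 − p′_ν²/12)]⁻¹`; with `one_le_Fk`
this is `F_k = 1 + O(|p′|²)` two-sided, k-uniform (sharp germ on paper: `F_k = 1 + [(1−η²)/12](|p′|² + p′_μ² + p′_ν²) + O(|p′|⁴)`). [folklore] -/
theorem Fk_le_local (n : ℕ) [NeZero n] (hn : 1 ≤ n) (s : Fin d → ℝ) (hs : ∀ ν, |s ν| ≤ π) (μ ν : Fin d)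
    (h12 : ∑ κ, s κ ^ 2 < 12) :
    Fk n μ ν s ≤ ((1 - (∑ κ, s κ ^ 2) / 12) * (1 - s μ ^ 2 / 12) * (1 - s ν ^ 2 / 12))⁻¹ := by
  unfold Fk
  have hsμ : s μ ^ 2 ≤ ∑ κ, s κ ^ 2 := Finset.single_le_sum (f := fun κ => s κ ^ 2) (fun κ _ => sq_nonneg _) (Finset.mem_univ μ)
  have hsν : s ν ^ 2 ≤ ∑ κ, s κ ^ 2 := Finset.single_le_sum (f := fun κ => s κ ^ 2) (fun κ _ => sq_nonneg _) (Finset.mem_univ ν)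
  have a1 : 0 < 1 - (∑ κ, s κ ^ 2) / 12 := by linarith
  have a2 : 0 < 1 - s μ ^ 2 / 12 := by linarith
  have a3 : 0 < 1 - s ν ^ 2 / 12 := by linarith
  have b1 := one_sub_sq_le_Ur_zero n hn s hs
  have b2 := one_sub_sq_le_uFactorr_zero n hn (hs μ)
  have b3 := one_sub_sq_le_uFactorr_zero n hn (hs ν)
  have hlow : (1 - (∑ κ, s κ ^ 2) / 12) * (1 - s μ ^ 2 / 12) * (1 - s ν ^ 2 / 12)
      ≤ Ur n (fun _ => (0 : Fin n)) s * uFactorr n 0 (s μ) * uFactorr n 0 (s ν) :=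
    mul_le_mul (mul_le_mul b1 b2 a2.le (Ur_zero_pos n hn s hs).le) b3 a3.le
      (mul_nonneg (Ur_nonneg _ _ _) (uFactorr_nonneg _ _ _))
  exact (inv_le_inv₀ (lt_of_lt_of_le (by positivity) hlow) (by positivity)).mpr hlow

end

end Literature.MathematicalPhysics.QuantumFieldTheory.Balaban1983to89.Beta.SymbolExpansion
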